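import Summits.AnomalousDissipation.AnomalousDissipation.Theorems.QuarticGate.Negative.EnergyRow
import Summits.AnomalousDissipation.AnomalousDissipation.Theorems.QuarticGate.Negative.Laminar
import Summits.AnomalousDissipation.AnomalousDissipation.Theorems.CubicParityLoud.Negative.MeanFlow

/-!
# Disproof of `GalerkinInvariantLoud` — findings of the standing adversary
(cdisprove seat refuter-cdisprove-stmt-AnomalousDissipation-14283-0, cycle 1, 2026-08-16; crux
stmt-AnomalousDissipation-14283, route MomentParity rank 4 = the `d = ∞` rung of the target `MomentLadder`)

Crux (`Theses.MomentParity.GalerkinInvariantLoud`, restated by `galerkinInvariantLoud_iff`, `Iff.rfl`):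
`∃ f` smooth div-free mean-zero, `ν_j → 0` (positive), `E`, `ε > 0`, `∀ j ∃ R ∃ᶠ N ∃ μ` a probability law on
`H = L²_σ(T³)` that is level-`N` carried, supported in `‖u‖ ≤ R`, ALL-ORDER polynomially stationary for Galerkin NS
at `(ν_j, f)` (`IsInvariant`), with `ensembleEnergy μ ≤ E` and `ε ≤ ensembleDissipation ν_j μ` (`IsGILWitness`).

## VERDICT (cycle 1): NO KILL. Why it resists
* The statement is a faithful "zeroth law for Galerkin-invariant ensembles": no junk operator bites (every Bochner
  integrand is smooth × `L²`; `eGradNormSq` is finite at level `N` by Bernstein; on level-`N` `u` and band tests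
  `w`, `nsGeneratorPairing ν f u w = ⟨P_N F(u), w⟩` is exactly the Galerkin generator with force `P_N P_σ f`).
* A kill is `not_galerkinInvariantLoud_iff` / `_absorbing`: for EVERY admissible force and EVERY `ν_j → 0`, some
  `ν_j` at which, for all large `N`, every compactly supported Galerkin-invariant level-`N` law of energy `≤ E` has
  `ν_j∫‖∇u‖² < ε` — a uniform-in-`N` laminarisation theorem for 3-D Galerkin NS including all unstable steady
  states, periodic orbits and SRB-type measures of the truncations. Nothing of the kind is known for any 3-D force
  (its 2-D analogue IS true: enstrophy Casimir, Alexakis–Doering `ε ≲ ν^{1/2}` = route item `PlanarCubicQuiet`);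
  converged DNS (Kaneda et al. 2003) says the opposite. The barrier catalogue
  (`Literature/Barriers/AnomalousDissipation/*`: Cheskidov 2023 Thm 1.3 force-robustness, Alexakis–Doering 2-D,
  Marchioro 1986 gravest-mode 2-D attraction, Brenier–De Lellis–Székelyhidi) contains no 3-D Galerkin quietness
  mechanism; `ledger negatives` for the summit has nothing of this shape.
* Unlike the lower rungs (`QuarticGate`, `CubicParityLoud`) this crux CANNOT be faked by designer measures:
  all-order stationarity on a compact level-`N` support is flow-invariance, and §4 proves the atomic case outright
  (atoms must be Galerkin steady states). So the crux is exactly as hard as producing genuinely invariant loud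
  bounded-energy Galerkin ensembles N-frequently along `ν_j → 0` — the converged-DNS zeroth law (planner: XL).

## What IS proved here (sorry-free; LANDED under `Theorems/GalerkinInvariantLoud/Negative/`: `Clauses` p80511 (§0–§2b),
## `Viscosity` p84243 (§2d), `Absorbing` p82868 (§3), `Atoms` p82971 (§4), `EnergyFloor` p88748 (§5), `TaylorCone` p89134 (§6))
§0 `IsInvariant`, `IsGILWitness`, `galerkinInvariantLoud_iff` (`Iff.rfl`).
§1 `IsGILWitness.isQuarticWitness`, `quarticGate_of_galerkinInvariantLoud` (the route's "implies QuarticGate",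
   kernel-checked; work-file only — positive in a route item), `not_galerkinInvariantLoud_of_not_quarticGate`:
   every negative fact on `QuarticGate` witnesses (`Theorems/QuarticGate/Negative/*`) transfers.
§2 necessary conditions on a witness at `(f, ν, N, R, E, ε)`: `eps_le_level` `ε ≤ 4π²N²νE` (Bernstein, no
   stationarity), `dissipation_eq` `ν∫‖∇u‖²dμ = ∫(u,f)dμ` (energy row), `eps_le_force` `ε ≤ ‖f‖₂√E`,
   `eps_le_radius` `ε ≤ ‖f‖₂R` (new clause). §2b the LOAD-BEARING TABLE — refuted strengthenings
   `not_gilBoundedLevel` (level before `j`), `not_gilEveryForce` (`f = 0` quiet), `not_gilSubFloor` (`‖f‖₂√E < ε`),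
   `not_gilSmallRadius` (`‖f‖₂R < ε`); weakenings that HOLD `gilWithoutEpsPos_holds` (`δ₀`),
   `gilWithoutEnergyCeiling_holds` (laminar Kolmogorov Diracs `δ_{K_1/(4π²ν_j)}`, radius `R_j = (4π²ν_j)⁻¹` — the
   crux lets `R` depend on `j`), `gilFixedViscosity_holds` (at `ν ≡ 1` the laminar Dirac is loud, bounded,
   compactly supported and invariant at every order: `isGILWitness_dirac_kolState`). Every clause is necessary.
§2d (via the sibling `CubicParityLoud/Negative/MeanFlow.lean`) `IsGILWitness.isWitness3`, `eps_le_meanFlow`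
   (`ε ≤ ‖f‖₂‖ū_N‖₂`: a MACROSCOPIC level-`N` mean flow is necessary), `laminar` (`ε ≤ ‖f‖₂²/(4π²ν)`), and the
   refuted strengthening `not_gilEveryViscosity` (the viscosity sequence cannot be quantified universally: its
   onset must lie below the laminar threshold `‖f‖₂²/(4π²ε)`).
§3 NEW `ae_norm_le_absorbing`: a finite law, level-`N` carried, supported in SOME ball, all-order stationary, is
   carried by the ABSORBING BALL `‖u‖ ≤ ‖f‖₂/(4π²ν)` — from the rows of `(Σᵢ(u,gᵢ)²)^(n+1)` alone (Poincaré +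
   `(b/a)^{2n} → 0`; no Weierstrass, no flow). Hence `IsGILWitness.absorbing` and
   `not_galerkinInvariantLoud_iff_absorbing`: the clause `∃ R` carries NO information beyond compactness; provers may
   set `R_j := ‖f‖₂/(4π²ν_j)`, refuters need only kill that radius.
§4 NEW `steady_of_isInvariant_atomic` / `isInvariant_atomic_of_steady`: a finitely atomic law with distinct
   level-`N` atoms is all-order stationary IFF every atom is a Galerkin steady state (`IsGalerkinSteady`: the
   generator vanishes on all band tests) — gradient interpolation by `(X₀ − c_a)Π_{b≠a}|X − c_b|⁴` in the
   coordinates `(g₀, frame)`, frame coordinates separating level-`N` fields (`eq_of_pairing_frameG_eq`).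
   `exists_efficient_steady_atom`: an atomic witness contains a steady atom with `ε‖u‖² ≤ E·ν‖∇u‖²` — an EFFICIENT
   loud steady state (the laminar family has ratio `4π²ν → 0` and never serves). The atomic sub-case of the crux is
   therefore route MirrorVariety's open loud-steady-state problem; genuine progress needs DIFFUSE invariant measures
   (Krylov–Bogoliubov time averages), for which loudness `= (f, ū) ≥ ε` is the whole content.

§5 NEW `exists_energyFloor`: the LINEAR row of `(u,f)` (mean momentum balance tested on `f`, when level `N`
   carries `f`) gives `∫‖f‖² ≤ |ν|‖Δf‖₂√E + C_f E` — an energy floor `E ≥ E₀(f) > 0` at small `ν` that, unlike the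
   force floor, does not degenerate with `ε`.

## Attacks tried (cycle 1) → outcome
junk/elaboration readback → faithful; degenerate forces (`f = 0`, gradient/constant forces do no work on `H`) →
only the `∀ f` strengthening dies; bounded levels / Taylor window → `N ≳ ν^{-1/2}` necessary, not a kill; small
radius / small energy → floors `R, √E ≥ ε/‖f‖₂`, attained by the laminar family at fixed `ν`; designer atomic
measures → impossible unless steady (§4); support localisation → absorbing ball automatic (§3); Gaussian laws →
never 3-stationary (Stein identity, sibling seat; not formalised); planar (2-component, `x₃`-independent) laws →
quiet by the Galerkin enstrophy Casimir (Alexakis–Doering) — the one KNOWN quietness mechanism, to be formalised as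
`PlanarCubicQuiet` (route support item), it constrains witnesses to be genuinely 3-D but kills nothing; literature
negatives → `lit search` rc 75 throughout this cycle (searchd down), grounder/one-shot refuter notes concur: no
rigorous `ν`-uniform dissipation floor or ceiling `→ 0` for any autonomous 3-D body force.

## For provers (briefing)
* Your witness measures must be genuinely invariant (time averages / SRB / unstable steady or periodic Diracs);
  their loudness is `∫(u,f)dμ = (f, ū) ≥ ε`: the MEAN FLOW must keep an `O(1)` projection on `f` at bounded energy.
* `E ≥ (ε/‖f‖₂)²`, `N ≥ (ε/(4π²ν_jE))^{1/2}`, `R_j = ‖f‖₂/(4π²ν_j)` free; atoms must be steady AND efficient.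
* Numerical probe (NUMERICS below): long-time Galerkin averages for Kolmogorov forcing `sin(4πy)e₀` at
  `N ≤ 16`, `ν ≥ 10⁻³` are loud (`D ≈ 0.11–0.16`, rising as `ν ↓`) at energy `≤ 0.41` — no sign of depletion.

## NUMERICS (kit job j012899, cmp-10, 16 cores × 44 min, exit 0; `dns/main.py` of the seat; evidence `compute-j012899`)
Galerkin NS on the unit `T³` (spherical truncation `0 < |k| ≤ N`, exactly dealiased pseudo-spectral, IF-RK4; self-tests:
laminar residual `2e-33`, inviscid energy drift `1e-10`/20 steps, `div 6e-16`), Kolmogorov force `f = sin(4πy)e₀`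
(`‖f‖₂ = 2^{-1/2}`), time averages over `t ∈ [40, 200]` (half-run spread of `D` ≤ `0.009`):

  ν      | N=6    N=8    N=12   N=16  ← D = ν⟨‖∇u‖²⟩ (= ⟨(f,u)⟩ = (f,ū) to 3 digits: energy row, mean-flow work)
  0.008  | 0.110  0.110  0.110  0.110   (a NON-laminar steady state: E2 = R_max² = 0.161; laminar: D 0.396, E2 0.313)
  0.004  | 0.126  0.121  0.121  0.125   E2 ≈ 0.29, R_max ≈ 0.62
  0.002  | 0.141  0.149  0.149  0.149   E2 ≈ 0.34, R_max ≈ 0.67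
  0.001  | 0.137  0.141  0.157  0.160   E2 ≈ 0.40, R_max ≈ 0.71   (level ceilings 4π²N²νE2 ≥ 0.57, force floor 0.44)

Reading: over a factor 8 in `ν` the time-average Galerkin dissipation does NOT decrease (it rises ≈ 45 %) at bounded
energy (`E2 ≤ 0.41`) and radius (`≤ 0.72`), uniformly in the tested levels `N ≥ 8` (under-resolution at `N = 6, 8`,
`ν = 10⁻³` costs ≤ 12 %): numerically, witnesses with `f = sin(4πy)e₀`, `E = 1/2`, `ε = 1/10`,
`R_j = ‖f‖₂/(4π²ν_j)` exist down to `ν = 10⁻³` at every level tried — the crux behaves TRUE where it can be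
computed (modest `Re`; evidence, not proof; the time-average measures are the Krylov–Bogoliubov witnesses a prover
would have to control analytically).

## Targets (lead's stuck stubs): none posted (payload.targets = []).
## Line `taylor-cone-homogenisation` (PICKED.md 06:14Z; skeleton rc 0 / 4 sorries, `GalerkinInvariantLoud_of`
## proof-of-item by name modulo S1–S4 — checked): NO STUB IS FALSE AS TYPED (§6).
* S1 `stub_energyFloor` — TRUE (M): my §5 row with `g₀ = P_N f`; constants `G = sup_N ‖∇P_N f‖_∞ ≤ 2πΣ|k|‖f̂(k)‖`,
  `N₀` with `‖P_N f‖₂² ≥ ‖f‖₂²/2`; the level clause is not even needed. (The landed `exists_energyFloor`, p88748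
  pending, is its band-limited case.)
* S2 `stub_taylorReduction` — TRUE (M): arithmetic; mind `e = 0` (then `κe ≤ D` is free and loudness comes only
  from S1's `e ≥ e₀`, which needs `N ≥ N₀` inside the `∃ᶠ N` — `Frequently.and_eventually`, as planned).
* S3 `stub_krylovBogoliubov` — TRUE (L) for the genuine semiflow (`Torus.galerkinFlow` = identity only OFF
  `IsGalerkinMode`, which is assumed); `κ ≤ 0`: any steady Dirac in the absorbing ball serves (Brouwer steady state
  or the K–B law itself); liminf honest (ratio ∈ [4π²ν, 4π²N²ν] by Poincaré/Bernstein on slices, `0/0 := 0` only on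
  the zero orbit, which is an orbit only when `P_N f = 0`). Its radius is exactly §3's absorbing radius.
* S4 `stub_oneTrajectoryTaylor` — OPEN = the crux in ratio currency (GIL ⇒ S4 by ergodic decomposition of a cone
  law + Birkhoff; S4 ⇒ GIL by S3,S2,S1). Load-bearing clause: the `j`-UNIFORM `κ` ONLY — `tseWithoutUniformKappa_holds`
  (§6: laminar Diracs sit on the cone of slope `4π²ν_j`), `f ≠ 0` (triage's decaying-mode witness), `ν_j → 0`.
  NUMERICS for S4 (j012899, K–B ratios `κ_KB = D/E2` of the time-average laws, `f = sin(4πy)e₀`, `N = 16`):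
  `0.68 (ν=.008, steady), 0.43 (.004), 0.43 (.002), 0.40 (.001)`; `N = 8`: `0.68, 0.41, 0.44, 0.36` — one datum per
  `(ν, N)` with cumulative ratio `≥ κ := 1/3` exists numerically across the decade, `N ≥ 8`.
* `certificate_excludes_cone` (the disprover's target): a one-multiplier polynomial certificate at `(ν_j, N)` would
  contradict the K–B laws above wherever DNS finds `κ_KB > κ`; certificates can exist only at levels/viscosities
  where EVERY invariant law is sub-cone — none of the 16 computed `(ν, N)` pairs qualifies for `κ ≤ 0.35`. No SDP
  search run (it could only exclude finitely many `N`, never the `∃ᶠ N`).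
-/

namespace Summit.AnomalousDissipation.AnomalousDissipation.Cruxes.GalerkinInvariantLoud.Disproof

open MeasureTheory Filter Topology
open scoped ENNReal InnerProductSpace RealInnerProductSpace
open Literature.Analysis.FunctionSpaces Literature.Analysis.FluidPDE
open Summit.AnomalousDissipation.AnomalousDissipation.Theses.MomentParity
open Summit.AnomalousDissipation.AnomalousDissipation.Theorems
open Summit.AnomalousDissipation.AnomalousDissipation.Theorems.QuarticGate.Negative

set_option linter.dupNamespace false

noncomputable section

-- `T3`, `R3`, `H3`, `L2T3` (torus, values, energy space, `L²`), the level-`N` Galerkin frame `frameG N`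
-- and the energy polynomial `energyPoly` are the sibling seat's (CubicParityLoud) abbreviations.
open Summit.AnomalousDissipation.AnomalousDissipation.Theorems.CubicParityLoud.Negative
  (T3 R3 H3 L2T3 frameG energyPoly isBandTest_frameG eval_pderiv_energyPoly polyGrad_energy
   fourierTruncate_ae_eq_of_isLevel eGradNormSq_fourierTruncate_of_isLevel eGradNormSq_lt_top_of_isLevel
   inertialPairing_fourierTruncate_of_isLevel integral_inner_fourierTruncate_of_isLevel integrable_pairing)

/-! ## §0 Vocabulary: the clauses of the crux, named (verbatim sub-terms of `GalerkinInvariantLoud`) -/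

/-- ALL-ORDER polynomial stationarity of `μ` for Galerkin NS at `(ν, f)`, level `N` (the stationarity
clause of `GalerkinInvariantLoud`: every polynomial cylindrical observable with level-`N` band tests is
drift-free — no degree bound). -/
def IsInvariant (ν : ℝ) (f : T3 → R3) (N : ℕ) (μ : Measure H3) : Prop :=
  ∀ (m : ℕ) (g : Fin m → T3 → R3) (P : MvPolynomial (Fin m) ℝ), (∀ i, IsBandTest N (g i)) →
    Integrable (fun u => Torus.nsGeneratorPairing ν f u (polyGrad g P u)) μ ∧
      ∫ u, Torus.nsGeneratorPairing ν f u (polyGrad g P u) ∂μ = 0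

/-- The witness clauses of `GalerkinInvariantLoud` at `(f, ν, N, R, E, ε)`: probability, level-`N`
carried, supported in `‖u‖ ≤ R`, all-order stationary, mean energy `≤ E`, dissipation `≥ ε`. -/
def IsGILWitness (f : T3 → R3) (ν : ℝ) (N : ℕ) (R E ε : ℝ) (μ : Measure H3) : Prop :=
  IsProbabilityMeasure μ ∧ (∀ᵐ u ∂μ, IsLevel N u) ∧ (∀ᵐ u ∂μ, ‖u‖ ≤ R) ∧ IsInvariant ν f N μ ∧
    Torus.ensembleEnergy μ ≤ E ∧ ε ≤ Torus.ensembleDissipation ν μ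

/-- `GalerkinInvariantLoud` restated through the vocabulary (definitional unfolding, `Iff.rfl`). -/
theorem galerkinInvariantLoud_iff :
    GalerkinInvariantLoud ↔ ∃ f : T3 → R3, Torus.IsSmooth f ∧ Torus.IsDivFree f ∧ Torus.HasZeroMean f ∧
      ∃ (ν : ℕ → ℝ) (E ε : ℝ), (∀ j, 0 < ν j) ∧ Tendsto ν atTop (𝓝 0) ∧ 0 < ε ∧
      ∀ j : ℕ, ∃ R : ℝ, ∃ᶠ N in atTop, ∃ μ, IsGILWitness f (ν j) N R E ε μ :=
  Iff.rfl

/-! ## §1 `GalerkinInvariantLoud ⇒ QuarticGate`: every negative fact about `QuarticGate` witnesses transfers -/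

/-- All-order stationarity gives `d`-stationarity for every `d`. -/
theorem IsInvariant.isPolyStationary {ν : ℝ} {f : T3 → R3} {N : ℕ} {μ : Measure H3}
    (h : IsInvariant ν f N μ) (d : ℕ) : IsPolyStationary ν f N d μ :=
  fun m g P hg _ => h m g P hg

/-- All-order stationarity is `d`-stationarity for every `d`. -/
theorem isInvariant_iff_forall {ν : ℝ} {f : T3 → R3} {N : ℕ} {μ : Measure H3} :
    IsInvariant ν f N μ ↔ ∀ d, IsPolyStationary ν f N d μ :=
  ⟨fun h d => h.isPolyStationary d, fun h m g P hg => h (P.totalDegree + 1) m g P hg le_rfl⟩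

/-- A law supported in a ball has moments of every order. -/
theorem integrable_norm_pow_of_ae_le {μ : Measure H3} [IsFiniteMeasure μ] {R : ℝ}
    (hR : ∀ᵐ u ∂μ, ‖u‖ ≤ R) (p : ℕ) : Integrable (fun u : H3 => ‖u‖ ^ p) μ := by
  refine Integrable.mono' (integrable_const (max R 0 ^ p)) (continuous_norm.pow p).aestronglyMeasurable ?_
  filter_upwards [hR] with u hu
  rw [Real.norm_of_nonneg (by positivity)]
  exact pow_le_pow_left₀ (norm_nonneg _) (hu.trans (le_max_left _ _)) p

/-- **A witness of this crux is a witness of `QuarticGate`** (bounded support gives the fourth moments,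
all-order stationarity gives 4-stationarity): every negative fact about `QuarticGate` witnesses transfers. -/
theorem IsGILWitness.isQuarticWitness {f : T3 → R3} {ν : ℝ} {N : ℕ} {R E ε : ℝ} {μ : Measure H3}
    (h : IsGILWitness f ν N R E ε μ) : IsQuarticWitness f ν N E ε μ := by
  obtain ⟨hp, hl, hR, hinv, hE, hε⟩ := h
  exact ⟨hp, hl, integrable_norm_pow_of_ae_le hR 4, hinv.isPolyStationary 4, hE, hε⟩

/-- The route's claim "GalerkinInvariantLoud implies QuarticGate", kernel-checked. -/
theorem quarticGate_of_galerkinInvariantLoud (h : GalerkinInvariantLoud) : QuarticGate := by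
  obtain ⟨f, hfs, hfd, hfz, ν, E, ε, hν, hν0, hε, hj⟩ := galerkinInvariantLoud_iff.1 h
  refine quarticGate_iff.2 ⟨f, hfs, hfd, hfz, ν, E, ε, hν, hν0, hε, fun j => ?_⟩
  obtain ⟨R, hR⟩ := hj j
  exact hR.mono fun N ⟨μ, hμ⟩ => ⟨μ, hμ.isQuarticWitness⟩

/-- Contrapositive: a refutation of `QuarticGate` refutes this crux. -/
theorem not_galerkinInvariantLoud_of_not_quarticGate (h : ¬ QuarticGate) : ¬ GalerkinInvariantLoud :=
  fun hG => h (quarticGate_of_galerkinInvariantLoud hG)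

/-! ## §2 Necessary conditions on witnesses (inherited + the radius floor) and refuted strengthenings -/

section Necessary

variable {f : T3 → R3} {ν : ℝ} {N : ℕ} {R E ε : ℝ} {μ : Measure H3}

/-- LEVEL CEILING: `ε ≤ 4π²N²νE` (Bernstein; stationarity not used). -/
theorem IsGILWitness.eps_le_level (hν : 0 ≤ ν) (h : IsGILWitness f ν N R E ε μ) :
    ε ≤ 4 * Real.pi ^ 2 * (N : ℝ) ^ 2 * ν * E :=
  h.isQuarticWitness.eps_le hν

/-- ENERGY ROW: the dissipation of a witness IS the mean injected power `∫ (u,f) dμ`. -/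
theorem IsGILWitness.dissipation_eq (hf : MemLp f 2 volume) (h : IsGILWitness f ν N R E ε μ) :
    Torus.ensembleDissipation ν μ = ∫ u, Torus.pairing u.1 f ∂μ := by
  obtain ⟨hp, hl, hR, hinv, -, -⟩ := h
  exact ensembleDissipation_eq_of_polyStationary f hf hl (integrable_norm_pow_of_ae_le hR 2) le_rfl
    (hinv.isPolyStationary 3)

/-- FORCE FLOOR: `ε ≤ ‖f‖₂ √E`. -/
theorem IsGILWitness.eps_le_force (hf : MemLp f 2 volume) (h : IsGILWitness f ν N R E ε μ) :
    ε ≤ Real.sqrt (∫ x, ‖f x‖ ^ 2) * Real.sqrt E :=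
  h.isQuarticWitness.eps_le_force hf

/-- RADIUS FLOOR (new clause of this crux): `ε ≤ ‖f‖₂ R` — the support radius of a witness is at least
`ε/‖f‖₂` (power `∫(u,f)dμ ≤ ‖f‖₂ ∫‖u‖dμ ≤ ‖f‖₂ R`). -/
theorem IsGILWitness.eps_le_radius (hf : MemLp f 2 volume) (h : IsGILWitness f ν N R E ε μ) :
    ε ≤ ‖hf.toLp f‖ * R := by
  have hdiss := h.dissipation_eq hf
  obtain ⟨hp, hl, hR, hinv, -, hε⟩ := h
  have h1 : Integrable (fun u : H3 => ‖u‖) μ := by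
    simpa using integrable_norm_pow_of_ae_le hR 1
  have hpair : ∫ u, Torus.pairing u.1 f ∂μ ≤ ∫ u, ‖hf.toLp f‖ * R ∂μ := by
    refine integral_mono_ae (CubicParityLoud.Negative.integrable_pairing hf h1) (integrable_const _) ?_
    filter_upwards [hR] with u hu
    calc Torus.pairing u.1 f ≤ |Torus.pairing u.1 f| := le_abs_self _
      _ ≤ ‖u‖ * ‖hf.toLp f‖ := Torus.abs_pairing_coe_le hf u
      _ ≤ R * ‖hf.toLp f‖ := mul_le_mul_of_nonneg_right hu (norm_nonneg _)
      _ = ‖hf.toLp f‖ * R := mul_comm _ _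
  rw [integral_const, smul_eq_mul, probReal_univ, one_mul] at hpair
  linarith

end Necessary

/-! ### §2b Refuted natural strengthenings, and the weakenings that hold (the load-bearing table)

Each clause of the crux is necessary for non-triviality: `0 < ε` (W1: `δ₀`), `ensembleEnergy ≤ E` (W2: laminar
Kolmogorov Diracs, `R_j = (4π²ν_j)⁻¹`), `ν_j → 0` (W3: at fixed viscosity the laminar Dirac is loud AND bounded),
`∃ f` (S2: `f = 0` is quiet), `∃ᶠ N` unbounded (S1: a level uniform in `j` is quiet), and the two floors
`‖f‖₂√E ≥ ε` (S3), `‖f‖₂ R ≥ ε` (S4). -/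

section Table

/-- The laminar Kolmogorov Dirac `δ_{K_a}`, `a = (4π²ν)⁻¹`, is a witness of ALL clauses of the crux at FIXED
viscosity, for the force `K_1 = cos(2πx₁)e₀`, at every level `N ≥ 1`: radius `a`, energy `a²/2`, dissipation
`(8π²ν)⁻¹` (exact steady state at every order; sibling file `QuarticGate/Negative/Laminar.lean`). -/
theorem isGILWitness_dirac_kolState {ν : ℝ} (hν : 0 < ν) {N : ℕ} (hN : 1 ≤ N) :
    IsGILWitness (kolField 1) ν N (4 * Real.pi ^ 2 * ν)⁻¹ ((4 * Real.pi ^ 2 * ν)⁻¹ ^ 2 / 2)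
      (8 * Real.pi ^ 2 * ν)⁻¹ (Measure.dirac (kolState (4 * Real.pi ^ 2 * ν)⁻¹)) := by
  haveI : MeasurableSingletonClass H3 := OpensMeasurableSpace.toMeasurableSingletonClass
  obtain ⟨⟨hp, hl, -, -, hE, hD⟩, -⟩ := isQuarticWitness_dirac_kolState hν hN
  set a : ℝ := (4 * Real.pi ^ 2 * ν)⁻¹ with ha
  have ha0 : 0 < a := by positivity
  have hforce : kolField 1 = kolField (4 * Real.pi ^ 2 * ν * a) := by
    rw [ha, mul_inv_cancel₀ (by positivity)]
  refine ⟨hp, hl, ?_, ?_, hE, hD⟩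
  · rw [ae_dirac_eq]
    simp only [Filter.eventually_pure]
    have h2 := norm_sq_kolState a
    nlinarith [norm_nonneg (kolState a)]
  · rw [isInvariant_iff_forall, hforce]
    exact fun d => isPolyStationary_dirac_kolState ν a N d

/-- STRENGTHENING 1 (refuted): the level `N` chosen BEFORE `j` (even only frequently in `j`, any radii). -/
def GILBoundedLevel : Prop :=
  ∃ f : T3 → R3, Torus.IsSmooth f ∧ Torus.IsDivFree f ∧ Torus.HasZeroMean f ∧
    ∃ (ν : ℕ → ℝ) (E ε : ℝ), (∀ j, 0 < ν j) ∧ Tendsto ν atTop (𝓝 0) ∧ 0 < ε ∧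
    ∃ N : ℕ, ∃ᶠ j in atTop, ∃ (R : ℝ) (μ : Measure H3), IsGILWitness f (ν j) N R E ε μ

/-- **`¬ GILBoundedLevel`** (level ceiling `ε ≤ 4π²N²ν_jE → 0`): witnesses live at `N ≳ ν_j^{-1/2}`. -/
theorem not_gilBoundedLevel : ¬ GILBoundedLevel := by
  rintro ⟨f, -, -, -, ν, E, ε, hν, hν0, hε, N, hfreq⟩
  obtain ⟨j, ⟨R, μ, hμ⟩, hno⟩ :=
    (hfreq.and_eventually (eventually_not_isQuarticWitness f hν hν0 E hε N)).exists
  exact hno μ hμ.isQuarticWitness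

/-- STRENGTHENING 2 (refuted): the crux for EVERY admissible force. -/
def GILEveryForce : Prop :=
  ∀ f : T3 → R3, Torus.IsSmooth f → Torus.IsDivFree f → Torus.HasZeroMean f →
    ∃ (ν : ℕ → ℝ) (E ε : ℝ), (∀ j, 0 < ν j) ∧ Tendsto ν atTop (𝓝 0) ∧ 0 < ε ∧
    ∀ j : ℕ, ∃ R : ℝ, ∃ᶠ N in atTop, ∃ μ, IsGILWitness f (ν j) N R E ε μ

/-- **`¬ GILEveryForce`**: `f = 0` is quiet at every order (`ε ≤ ‖0‖₂√E = 0`). The `∃ f` is load-bearing: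
a witness force has `‖f‖₂ ≥ ε/√E` (and, Cheskidov 2023 Thm 1.3, the continuum zeroth law is not force-robust). -/
theorem not_gilEveryForce : ¬ GILEveryForce := by
  intro h
  have hzero : (Torus.realTrigPoly (∅ : Finset (Fin 3 → ℤ)) (0 : (Fin 3 → ℤ) → EuclideanSpace ℂ (Fin 3)))
      = fun _ => 0 := Torus.realTrigPoly_zero ∅
  obtain ⟨ν, E, ε, hν, -, hε, hj⟩ := h (fun _ => 0) (Torus.isSmooth_const _)
    (by rw [← hzero]; exact Torus.isDivFree_realTrigPoly fun k hk => by simp at hk)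
    (by simp [Torus.HasZeroMean])
  obtain ⟨R, hR⟩ := hj 0
  obtain ⟨N, μ, hμ⟩ := hR.exists
  have := hμ.eps_le_force (memLp_const 0)
  simp at this
  linarith

/-- STRENGTHENING 3 (refuted): an energy budget below the force floor, `‖f‖₂ √E < ε`. -/
def GILSubFloor : Prop :=
  ∃ f : T3 → R3, Torus.IsSmooth f ∧ Torus.IsDivFree f ∧ Torus.HasZeroMean f ∧
    ∃ (ν : ℕ → ℝ) (E ε : ℝ), (∀ j, 0 < ν j) ∧ Tendsto ν atTop (𝓝 0) ∧ 0 < ε ∧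
    Real.sqrt (∫ x, ‖f x‖ ^ 2) * Real.sqrt E < ε ∧
    ∀ j : ℕ, ∃ R : ℝ, ∃ᶠ N in atTop, ∃ μ, IsGILWitness f (ν j) N R E ε μ

/-- **`¬ GILSubFloor`** (energy row): every witness has `ε ≤ ‖f‖₂√E`; the laminar family attains it. -/
theorem not_gilSubFloor : ¬ GILSubFloor := by
  rintro ⟨f, hfs, -, -, ν, E, ε, hν, -, hε, hlt, hj⟩
  obtain ⟨R, hR⟩ := hj 0
  obtain ⟨N, μ, hμ⟩ := hR.exists
  have := hμ.eps_le_force (hfs.memLp 2)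
  linarith

/-- STRENGTHENING 4 (refuted; the new clause): support radii below the radius floor, `‖f‖₂ R_j < ε`. -/
def GILSmallRadius : Prop :=
  ∃ f : T3 → R3, Torus.IsSmooth f ∧ Torus.IsDivFree f ∧ Torus.HasZeroMean f ∧
    ∃ (ν : ℕ → ℝ) (E ε : ℝ), (∀ j, 0 < ν j) ∧ Tendsto ν atTop (𝓝 0) ∧ 0 < ε ∧
    ∀ j : ℕ, ∃ R : ℝ, Real.sqrt (∫ x, ‖f x‖ ^ 2) * R < ε ∧
      ∃ᶠ N in atTop, ∃ μ, IsGILWitness f (ν j) N R E ε μ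

/-- **`¬ GILSmallRadius`**: `ε ≤ ‖f‖₂ R` for every witness (power `≤ ‖f‖₂ ∫‖u‖ ≤ ‖f‖₂ R`). -/
theorem not_gilSmallRadius : ¬ GILSmallRadius := by
  rintro ⟨f, hfs, -, -, ν, E, ε, hν, -, hε, hj⟩
  obtain ⟨R, hlt, hR⟩ := hj 0
  obtain ⟨N, μ, hμ⟩ := hR.exists
  have h := hμ.eps_le_radius (hfs.memLp 2)
  rw [CubicParityLoud.Negative.norm_toLp_eq_sqrt] at h
  linarith

/-- WEAKENING 1 (holds trivially): the crux without `0 < ε`. -/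
def GILWithoutEpsPos : Prop :=
  ∃ f : T3 → R3, Torus.IsSmooth f ∧ Torus.IsDivFree f ∧ Torus.HasZeroMean f ∧
    ∃ (ν : ℕ → ℝ) (E ε : ℝ), (∀ j, 0 < ν j) ∧ Tendsto ν atTop (𝓝 0) ∧
    ∀ j : ℕ, ∃ R : ℝ, ∃ᶠ N in atTop, ∃ μ, IsGILWitness f (ν j) N R E ε μ

/-- `δ₀` with `f = 0` satisfies every clause with `R = E = ε = 0`. -/
theorem isGILWitness_dirac_zero (ν : ℝ) (hν : 0 ≤ ν) (N : ℕ) :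
    IsGILWitness (fun _ => 0) ν N 0 0 0 (Measure.dirac (0 : H3)) := by
  haveI : MeasurableSingletonClass H3 := OpensMeasurableSpace.toMeasurableSingletonClass
  refine ⟨inferInstance, ?_, ?_, ?_, ?_, ?_⟩
  · rw [ae_dirac_eq]
    simp only [Filter.eventually_pure]
    intro k _
    exact mFourierCoeff_coe_zero k
  · rw [ae_dirac_eq]
    simp
  · intro m g P _
    refine ⟨Torus.integrable_dirac _ _, ?_⟩
    rw [integral_dirac]
    exact nsGeneratorPairing_zero_zero ν _
  · simp [Torus.ensembleEnergy, integral_dirac]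
  · exact mul_nonneg hν ENNReal.toReal_nonneg

/-- **`0 < ε` is load-bearing** (`ν_j = 1/(j+1)`, `f = 0`, `δ₀`). -/
theorem gilWithoutEpsPos_holds : GILWithoutEpsPos := by
  have hzero : (Torus.realTrigPoly (∅ : Finset (Fin 3 → ℤ)) (0 : (Fin 3 → ℤ) → EuclideanSpace ℂ (Fin 3)))
      = fun _ => 0 := Torus.realTrigPoly_zero ∅
  refine ⟨fun _ => 0, Torus.isSmooth_const _, ?_, ?_, fun j => 1 / ((j : ℝ) + 1), 0, 0,
    fun j => by positivity, tendsto_one_div_add_atTop_nhds_zero_nat, fun j => ⟨0, ?_⟩⟩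
  · rw [← hzero]
    exact Torus.isDivFree_realTrigPoly fun k hk => by simp at hk
  · simp [Torus.HasZeroMean]
  · exact Frequently.of_forall fun N => ⟨_, isGILWitness_dirac_zero _ (by positivity) N⟩

/-- WEAKENING 2 (holds): the crux without the energy ceiling `ensembleEnergy μ ≤ E` (radius kept, `R` per `j`). -/
def GILWithoutEnergyCeiling : Prop :=
  ∃ f : T3 → R3, Torus.IsSmooth f ∧ Torus.IsDivFree f ∧ Torus.HasZeroMean f ∧
    ∃ (ν : ℕ → ℝ) (ε : ℝ), (∀ j, 0 < ν j) ∧ Tendsto ν atTop (𝓝 0) ∧ 0 < ε ∧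
    ∀ j : ℕ, ∃ R : ℝ, ∃ᶠ N in atTop, ∃ μ : Measure H3,
      IsProbabilityMeasure μ ∧ (∀ᵐ u ∂μ, IsLevel N u) ∧ (∀ᵐ u ∂μ, ‖u‖ ≤ R) ∧ IsInvariant (ν j) f N μ ∧
        ε ≤ Torus.ensembleDissipation (ν j) μ

/-- **The energy ceiling is load-bearing**: the laminar Kolmogorov Diracs `δ_{K_1/(4π²ν_j)}` (radius
`R_j = (4π²ν_j)⁻¹`, which the crux allows to depend on `j`) witness everything else, dissipation `(8π²ν_j)⁻¹ ≥ (8π²)⁻¹`. -/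
theorem gilWithoutEnergyCeiling_holds : GILWithoutEnergyCeiling := by
  have hpi : 0 < Real.pi := Real.pi_pos
  refine ⟨kolField 1, isSmooth_kolField 1, isDivFree_kolField 1, hasZeroMean_kolField 1,
    fun j => 1 / ((j : ℝ) + 1), (8 * Real.pi ^ 2)⁻¹, fun j => by positivity,
    tendsto_one_div_add_atTop_nhds_zero_nat, by positivity, fun j => ⟨(4 * Real.pi ^ 2 * (1 / ((j : ℝ) + 1)))⁻¹, ?_⟩⟩
  refine (eventually_ge_atTop 1).frequently.mono fun N hN => ?_
  set ν : ℝ := 1 / ((j : ℝ) + 1) with hν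
  have hν0 : 0 < ν := by positivity
  have hν1 : ν ≤ 1 := by
    rw [hν, div_le_one (by positivity)]; linarith [(Nat.cast_nonneg j : (0 : ℝ) ≤ j)]
  obtain ⟨hp, hl, hR, hinv, -, hD⟩ := isGILWitness_dirac_kolState hν0 hN
  refine ⟨_, hp, hl, hR, hinv, le_trans ?_ hD⟩
  exact inv_anti₀ (by positivity) (by nlinarith [hν1, hpi])

/-- WEAKENING 3 (holds): the crux without `ν_j → 0` (everything else kept, incl. the energy ceiling). -/
def GILFixedViscosity : Prop :=
  ∃ f : T3 → R3, Torus.IsSmooth f ∧ Torus.IsDivFree f ∧ Torus.HasZeroMean f ∧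
    ∃ (ν : ℕ → ℝ) (E ε : ℝ), (∀ j, 0 < ν j) ∧ 0 < ε ∧
    ∀ j : ℕ, ∃ R : ℝ, ∃ᶠ N in atTop, ∃ μ, IsGILWitness f (ν j) N R E ε μ

/-- **`ν_j → 0` is load-bearing**: at fixed viscosity `ν ≡ 1` the laminar Dirac is a loud, bounded-energy,
compactly supported, all-order invariant level-1 law (`E = (4π²)⁻²/2`, `ε = (8π²)⁻¹`). -/
theorem gilFixedViscosity_holds : GILFixedViscosity := by
  refine ⟨kolField 1, isSmooth_kolField 1, isDivFree_kolField 1, hasZeroMean_kolField 1, fun _ => 1,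
    ((4 * Real.pi ^ 2 * 1)⁻¹) ^ 2 / 2, (8 * Real.pi ^ 2 * 1)⁻¹, fun _ => one_pos, by positivity, fun j => ?_⟩
  exact ⟨(4 * Real.pi ^ 2 * 1)⁻¹, (eventually_ge_atTop 1).frequently.mono fun N hN =>
    ⟨_, isGILWitness_dirac_kolState one_pos hN⟩⟩

end Table

/-! ### §2d The onset viscosity is load-bearing: mean-flow floor, laminar ceiling, no `∀ν` version

Transfer to the sibling crux's witness notion (`CubicParityLoud.Negative.IsWitness`: 3-stationary, finite third
moments) and its mean-flow file: every witness carries a MACROSCOPIC level-`N` mean flow `‖ū_N‖₂ ≥ ε/‖f‖₂`, and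
obeys the LAMINAR CEILING `ε ≤ ‖f‖₂²/(4π²ν)`. Hence the strengthening in which the viscosity sequence is quantified
UNIVERSALLY (`∃ f E ε ∀ ν_j → 0 ∀ j …`) is FALSE: its first terms may exceed the laminar threshold `‖f‖₂²/(4π²ε)`. -/

section Viscosity

/-- A witness of this crux is a witness of `CubicParityLoud` at the same `(f, ν, N, E, ε)`. -/
theorem IsGILWitness.isWitness3 {f : T3 → R3} {ν : ℝ} {N : ℕ} {R E ε : ℝ} {μ : Measure H3}
    (h : IsGILWitness f ν N R E ε μ) : CubicParityLoud.Negative.IsWitness f ν N E ε μ := by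
  obtain ⟨hp, hl, hR, hinv, hE, hε⟩ := h
  exact ⟨hp, hl, integrable_norm_pow_of_ae_le hR 3, fun m g P hg hP => hinv m g P hg, hE, hε⟩

/-- **MEAN-FLOW FLOOR**: `ε ≤ ‖f‖₂ ‖ū_N‖₂` — loudness is the work of the level-`N` mean flow
`ū_N = Σᵢ (∫(u,eᵢ)dμ) eᵢ` (sibling `CubicParityLoud/Negative/MeanFlow.lean`). -/
theorem IsGILWitness.eps_le_meanFlow {f : T3 → R3} (hf : MemLp f 2 volume) {ν : ℝ} {N : ℕ} {R E ε : ℝ}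
    {μ : Measure H3} (h : IsGILWitness f ν N R E ε μ) :
    ε ≤ Real.sqrt (∫ x, ‖f x‖ ^ 2) * Real.sqrt (∫ x, ‖CubicParityLoud.Negative.meanFlow N μ x‖ ^ 2) :=
  h.isWitness3.le_meanFlow hf

/-- **LAMINAR CEILING**: `ε ≤ ‖f‖₂²/(4π²ν)` — witnesses exist only below the laminar threshold
`ν ≤ ‖f‖₂²/(4π²ε)`. -/
theorem IsGILWitness.laminar {f : T3 → R3} (hf : MemLp f 2 volume) {ν : ℝ} (hν : 0 < ν) {N : ℕ} {R E ε : ℝ}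
    (hε : 0 < ε) {μ : Measure H3} (h : IsGILWitness f ν N R E ε μ) :
    ε ≤ (∫ x, ‖f x‖ ^ 2) / (4 * Real.pi ^ 2 * ν) :=
  h.isWitness3.laminar hf hν hε

/-- STRENGTHENING 5 (refuted): the viscosity sequence quantified universally. -/
def GILEveryViscosity : Prop :=
  ∃ f : T3 → R3, Torus.IsSmooth f ∧ Torus.IsDivFree f ∧ Torus.HasZeroMean f ∧
    ∃ (E ε : ℝ), 0 < ε ∧ ∀ ν : ℕ → ℝ, (∀ j, 0 < ν j) → Tendsto ν atTop (𝓝 0) →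
    ∀ j : ℕ, ∃ R : ℝ, ∃ᶠ N in atTop, ∃ μ, IsGILWitness f (ν j) N R E ε μ

/-- **`¬ GILEveryViscosity`**: along `ν_j = K/(j+1)` with `K = ‖f‖₂²/(4π²ε) + 1` there is no witness at `j = 0`
(laminar ceiling). The `∃ ν` of the crux is load-bearing through its ONSET: any proof must start below
`‖f‖₂²/(4π²ε)`. -/
theorem not_gilEveryViscosity : ¬ GILEveryViscosity := by
  rintro ⟨f, hfs, -, -, E, ε, hε, h⟩
  have hpi : 0 < Real.pi := Real.pi_pos
  set F2 : ℝ := ∫ x, ‖f x‖ ^ 2 with hF2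
  have hF0 : 0 ≤ F2 := integral_nonneg fun x => by positivity
  set K : ℝ := F2 / (4 * Real.pi ^ 2 * ε) + 1 with hK
  have hK0 : 0 < K := by positivity
  have hν := h (fun j => K / ((j : ℝ) + 1)) (fun j => by positivity)
    ((tendsto_const_nhds.div_atTop (tendsto_natCast_atTop_atTop.atTop_add tendsto_const_nhds)))
  obtain ⟨R, hR⟩ := hν 0
  obtain ⟨N, μ, hμ⟩ := hR.exists
  have hlam := hμ.laminar (hfs.memLp 2) (by positivity) hε
  simp only [Nat.cast_zero, zero_add, div_one] at hlam
  -- `ε ≤ F2/(4π²K)` with `K > F2/(4π²ε)` is absurd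
  rw [le_div_iff₀ (by positivity)] at hlam
  have : ε * (4 * Real.pi ^ 2 * K) = F2 + ε * (4 * Real.pi ^ 2) := by
    rw [hK]; field_simp
  linarith [mul_pos hε (by positivity : (0 : ℝ) < 4 * Real.pi ^ 2)]

end Viscosity


/-! ## §3 NEW — the radius clause is FREE: compactly supported invariant level-`N` laws live in the
absorbing ball `‖u‖ ≤ ‖f‖₂/(4π²ν)` (FMRT IV (1.34) for genuine stationary statistical solutions; here
derived from POLYNOMIAL stationarity alone, via the rows of the powers `(Σᵢ(u,gᵢ)²)^(n+1)` of the energy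
observable over the Galerkin frame — no Weierstrass approximation, no flow). -/

section Absorbing

variable {ν : ℝ} {f : T3 → R3} {N : ℕ} {μ : Measure H3}

/-- `∂ᵢ (Σⱼ Xⱼ²)^(n+1) = (n+1) (Σⱼ Xⱼ²)^n · 2Xᵢ`, evaluated. -/
theorem eval_pderiv_energyPoly_pow {M : ℕ} (v : Fin M → ℝ) (i : Fin M) (n : ℕ) :
    MvPolynomial.eval v (MvPolynomial.pderiv i (energyPoly M ^ (n + 1))) =
      ((n : ℝ) + 1) * (∑ j, v j ^ 2) ^ n * (2 * v i) := by
  rw [Derivation.leibniz_pow, Nat.add_sub_cancel, map_nsmul, smul_eq_mul, map_mul, map_pow,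
    eval_pderiv_energyPoly, nsmul_eq_mul]
  have hE : MvPolynomial.eval v (energyPoly M) = ∑ j, v j ^ 2 := by
    simp [energyPoly, map_sum]
  rw [hE]
  push_cast
  ring

/-- The differential of the `(n+1)`-st power of the energy observable is `2(n+1) e(u)^n P_N u`,
`e(u) = Σⱼ (u,gⱼ)²`. -/
theorem polyGrad_energyPoly_pow (N : ℕ) (u : H3) (n : ℕ) :
    polyGrad (frameG N) (energyPoly _ ^ (n + 1)) u = fun x =>
      (((n : ℝ) + 1) * (∑ j, (Torus.pairing u.1 (frameG N j)) ^ 2) ^ n * 2) •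
        Torus.fourierTruncate N ((u : L2T3) : T3 → R3) x := by
  have h2 := polyGrad_energy N u
  funext x
  have h2x := congrFun h2 x
  simp only [polyGrad, CubicParityLoud.Negative.polyGrad, eval_pderiv_energyPoly] at h2x ⊢
  simp only [eval_pderiv_energyPoly_pow]
  have : ∀ i : Fin _, (((n : ℝ) + 1) * (∑ j, Torus.pairing u.1 (frameG N j) ^ 2) ^ n *
      (2 * Torus.pairing u.1 (frameG N i))) • frameG N i x =
      (((n : ℝ) + 1) * (∑ j, Torus.pairing u.1 (frameG N j) ^ 2) ^ n) •
        ((2 * Torus.pairing u.1 (frameG N i)) • frameG N i x) := fun i => by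
    rw [smul_smul]
  simp_rw [this, ← Finset.smul_sum, h2x, smul_smul]

/-- On level-`N` fields the frame energy is the energy: `Σⱼ (u,gⱼ)² = ‖u‖²`. -/
theorem sum_sq_pairing_frameG_of_isLevel {u : H3} (hu : IsLevel N u) :
    ∑ j, (Torus.pairing u.1 (frameG N j)) ^ 2 = ‖u‖ ^ 2 := by
  have h1 : ∑ j, (Torus.pairing u.1 (frameG N j)) ^ 2 =
      ∫ y, ‖Torus.fourierTruncate N ((u : L2T3) : T3 → R3) y‖ ^ 2 := by
    rw [← Torus.norm_sq_galerkinTest_coords N one_pos u, EuclideanSpace.real_norm_sq_eq]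
    rfl
  rw [h1, show ‖u‖ ^ 2 = ‖(u : L2T3)‖ ^ 2 from rfl, ← Torus.integral_norm_sq_coe_eq]
  refine integral_congr_ae ?_
  filter_upwards [fourierTruncate_ae_eq_of_isLevel hu] with x hx
  rw [hx]

/-- **The row integrand of `(Σ(u,gⱼ)²)^(n+1)` on level-`N` fields**:
`⟨F(u), ∇p(u)⟩ = 2(n+1)‖u‖^{2n} ((u,f) − ν‖∇u‖²)`. -/
theorem nsGeneratorPairing_energyPow_of_isLevel (ν : ℝ) (f : T3 → R3) {u : H3} (hu : IsLevel N u) (n : ℕ) :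
    Torus.nsGeneratorPairing ν f u (polyGrad (frameG N) (energyPoly _ ^ (n + 1)) u) =
      (((n : ℝ) + 1) * (‖u‖ ^ 2) ^ n * 2) *
        (Torus.pairing u.1 f - ν * (Torus.eGradNormSq ((u : L2T3) : T3 → R3)).toReal) := by
  rw [polyGrad_energyPoly_pow, Torus.nsGeneratorPairing_smul_fourierTruncate,
    sum_sq_pairing_frameG_of_isLevel hu, integral_inner_fourierTruncate_of_isLevel hu,
    eGradNormSq_fourierTruncate_of_isLevel hu, inertialPairing_fourierTruncate_of_isLevel hu, add_zero]

/-- `(‖∇u‖²).toReal ≤ 4π²N²‖u‖²` on level-`N` fields (Bernstein, real form). -/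
theorem toReal_eGradNormSq_le_of_isLevel {u : H3} (hu : IsLevel N u) :
    (Torus.eGradNormSq ((u : L2T3) : T3 → R3)).toReal ≤ 4 * Real.pi ^ 2 * (N : ℝ) ^ 2 * ‖u‖ ^ 2 := by
  have h := eGradNormSq_le_of_level (u : L2T3) hu
  have hfin : ENNReal.ofReal (4 * Real.pi ^ 2 * (N : ℝ) ^ 2) * ‖(u : L2T3)‖ₑ ^ 2 ≠ ⊤ :=
    ENNReal.mul_ne_top ENNReal.ofReal_ne_top (ENNReal.pow_ne_top enorm_ne_top)
  have h2 := ENNReal.toReal_mono hfin h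
  rw [ENNReal.toReal_mul, ENNReal.toReal_ofReal (by positivity), ← ofReal_norm,
    ← ENNReal.ofReal_pow (norm_nonneg _), ENNReal.toReal_ofReal (by positivity)] at h2
  exact h2

/-- **ABSORBING BALL from polynomial stationarity.** A finite law carried by level-`N` fields, supported in
SOME ball, whose rows of all powers of the frame energy observable vanish (in particular every all-order
stationary law of the crux), is carried by the absorbing ball `‖u‖ ≤ ‖f‖₂/(4π²ν)` (`0 < ν`).
Proof: the rows give `∫ ‖u‖^{2n} I dμ = 0`, `I = ν‖∇u‖² − (u,f) ≥ ‖u‖(4π²ν‖u‖ − ‖f‖₂)` (Poincaré);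
for `a > ρ` and `ρ < b < a`, `‖u‖^{2n} I ≥ a^{2n} c_a 𝟙_{‖u‖≥a} − b^{2n}|I|` pointwise, so
`μ(‖u‖ ≥ a) ≤ (b/a)^{2n} ∫|I|/c_a → 0`. Hence the clause `∃ R, ∀ᵐ ‖u‖ ≤ R` of the crux may always be
taken with `R = ‖f‖₂/(4π²ν_j)`: it carries no information beyond compactness of the support. -/
theorem ae_norm_le_absorbing (hν : 0 < ν) (hf : MemLp f 2 volume) [IsFiniteMeasure μ]
    (hlev : ∀ᵐ u ∂μ, IsLevel N u) {R : ℝ} (hR : ∀ᵐ u ∂μ, ‖u‖ ≤ R) (hinv : IsInvariant ν f N μ) :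
    ∀ᵐ u ∂μ, ‖u‖ ≤ ‖hf.toLp f‖ / (4 * Real.pi ^ 2 * ν) := by
  set F : ℝ := ‖hf.toLp f‖ with hF
  set ρ : ℝ := F / (4 * Real.pi ^ 2 * ν) with hρ
  have hF0 : 0 ≤ F := norm_nonneg _
  have hlam : 0 < 4 * Real.pi ^ 2 * ν := by positivity
  have hρ0 : 0 ≤ ρ := div_nonneg hF0 hlam.le
  -- the energy-balance integrand
  set D : H3 → ℝ := fun u => (Torus.eGradNormSq ((u : L2T3) : T3 → R3)).toReal with hD
  set I : H3 → ℝ := fun u => ν * D u - Torus.pairing u.1 f with hI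
  have h1 : Integrable (fun u : H3 => ‖u‖) μ := by simpa using integrable_norm_pow_of_ae_le hR 1
  -- (i) `I` is integrable (a.e. bounded and measurable)
  have hDmeas : AEStronglyMeasurable D μ :=
    (Torus.measurable_eGradNormSq_coe (d := Fin 3)).ennreal_toReal.aestronglyMeasurable
  have hDint : Integrable D μ := by
    refine Integrable.mono' ((integrable_norm_pow_of_ae_le hR 2).const_mul (4 * Real.pi ^ 2 * (N : ℝ) ^ 2))
      hDmeas ?_
    filter_upwards [hlev] with u hu
    rw [Real.norm_of_nonneg ENNReal.toReal_nonneg]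
    exact toReal_eGradNormSq_le_of_isLevel hu
  have hIint : Integrable I μ := (hDint.const_mul ν).sub (integrable_pairing hf h1)
  -- (ii) the rows of the powers of the energy observable
  have hrow : ∀ n : ℕ, ∫ u, ‖u‖ ^ (2 * n) * I u ∂μ = 0 := by
    intro n
    obtain ⟨-, hG0⟩ := hinv _ (frameG N) (energyPoly _ ^ (n + 1)) (fun i => isBandTest_frameG N i)
    have hae : (fun u => Torus.nsGeneratorPairing ν f u (polyGrad (frameG N) (energyPoly _ ^ (n + 1)) u))
        =ᵐ[μ] fun u => (-(2 * ((n : ℝ) + 1))) * (‖u‖ ^ (2 * n) * I u) :=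
      hlev.mono fun u hu => by
        show Torus.nsGeneratorPairing ν f u _ = _
        rw [nsGeneratorPairing_energyPow_of_isLevel ν f hu n]
        simp only [hI, hD, pow_mul]
        ring
    rw [integral_congr_ae hae, integral_const_mul] at hG0
    have hc : (-(2 * ((n : ℝ) + 1))) ≠ 0 := by
      have : (0 : ℝ) < 2 * ((n : ℝ) + 1) := by positivity
      linarith
    exact (mul_eq_zero.1 hG0).resolve_left hc
  -- (iii) Poincaré: `I u ≥ ‖u‖ (4π²ν‖u‖ − F)` a.e.
  have hlow : ∀ᵐ u ∂μ, ‖u‖ * (4 * Real.pi ^ 2 * ν * ‖u‖ - F) ≤ I u := by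
    filter_upwards [hlev] with u hu
    have hP := Torus.norm_sq_le_toReal_eGradNormSq u (eGradNormSq_lt_top_of_isLevel hu).ne
    have hp : Torus.pairing u.1 f ≤ ‖u‖ * F := (le_abs_self _).trans (Torus.abs_pairing_coe_le hf u)
    rw [hI, hD]
    dsimp only
    nlinarith [hν]
  -- (iv) every shell `{a ≤ ‖u‖}`, `a > ρ`, is null
  have hnull : ∀ a : ℝ, ρ < a → μ {u : H3 | a ≤ ‖u‖} = 0 := by
    intro a ha
    have ha0 : 0 < a := lt_of_le_of_lt hρ0 ha
    set b : ℝ := (ρ + a) / 2 with hb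
    have hρb : ρ < b := by rw [hb]; linarith
    have hba : b < a := by rw [hb]; linarith
    have hb0 : 0 < b := lt_of_le_of_lt hρ0 hρb
    have hgap : ∀ {t : ℝ}, ρ < t → 0 < 4 * Real.pi ^ 2 * ν * t - F := fun {t} ht => by
      rw [hρ, div_lt_iff₀ hlam] at ht
      linarith
    set c : ℝ := a * (4 * Real.pi ^ 2 * ν * a - F) with hc
    have hc0 : 0 < c := mul_pos ha0 (hgap ha)
    set S : Set H3 := {u | a ≤ ‖u‖} with hS
    have hSm : MeasurableSet S := measurableSet_le measurable_const continuous_norm.measurable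
    -- pointwise: `a^{2n} c 𝟙_S − b^{2n} |I| ≤ ‖u‖^{2n} I`
    have hpt : ∀ n : ℕ, ∀ᵐ u ∂μ,
        a ^ (2 * n) * c * S.indicator (fun _ => (1 : ℝ)) u - b ^ (2 * n) * |I u| ≤ ‖u‖ ^ (2 * n) * I u := by
      intro n
      filter_upwards [hlow] with u hu
      by_cases huS : u ∈ S
      · have hua : a ≤ ‖u‖ := huS
        rw [Set.indicator_of_mem huS, mul_one]
        have hIc : c ≤ I u := by
          have h1 : c ≤ ‖u‖ * (4 * Real.pi ^ 2 * ν * ‖u‖ - F) := by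
            rw [hc]
            apply mul_le_mul hua _ (hgap ha).le (norm_nonneg _)
            nlinarith
          exact h1.trans hu
        have hpow : a ^ (2 * n) ≤ ‖u‖ ^ (2 * n) := pow_le_pow_left₀ ha0.le hua _
        nlinarith [abs_nonneg (I u), mul_le_mul hpow hIc hc0.le (pow_nonneg (norm_nonneg u) _),
          pow_nonneg hb0.le (2 * n)]
      · rw [Set.indicator_of_notMem huS, mul_zero, zero_sub]
        by_cases hub : ‖u‖ ≤ b
        · have hpow : ‖u‖ ^ (2 * n) ≤ b ^ (2 * n) := pow_le_pow_left₀ (norm_nonneg _) hub _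
          nlinarith [neg_abs_le (I u), abs_nonneg (I u), pow_nonneg (norm_nonneg u) (2 * n),
            mul_le_mul_of_nonneg_right hpow (abs_nonneg (I u))]
        · rw [not_le] at hub
          have hI0 : 0 ≤ I u := by
            have : 0 ≤ ‖u‖ * (4 * Real.pi ^ 2 * ν * ‖u‖ - F) :=
              mul_nonneg (norm_nonneg _) (by nlinarith [hgap hρb])
            exact this.trans hu
          nlinarith [pow_nonneg (norm_nonneg u) (2 * n), abs_nonneg (I u), pow_nonneg hb0.le (2 * n),
            mul_nonneg (pow_nonneg (norm_nonneg u) (2 * n)) hI0]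
    -- integrate: `a^{2n} c μ(S) ≤ b^{2n} ∫ |I|`
    have hK : ∀ n : ℕ, a ^ (2 * n) * c * μ.real S ≤ b ^ (2 * n) * ∫ u, |I u| ∂μ := by
      intro n
      have hL : Integrable (fun u => a ^ (2 * n) * c * S.indicator (fun _ => (1 : ℝ)) u - b ^ (2 * n) * |I u|) μ :=
        (((integrable_const (1 : ℝ)).indicator hSm).const_mul _).sub (hIint.abs.const_mul _)
      have hRi : Integrable (fun u : H3 => ‖u‖ ^ (2 * n) * I u) μ := by
        obtain ⟨hGi, -⟩ := hinv _ (frameG N) (energyPoly _ ^ (n + 1)) (fun i => isBandTest_frameG N i)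
        have hae : (fun u : H3 => ‖u‖ ^ (2 * n) * I u) =ᵐ[μ] fun u =>
            (-(2 * ((n : ℝ) + 1)))⁻¹ *
              Torus.nsGeneratorPairing ν f u (polyGrad (frameG N) (energyPoly _ ^ (n + 1)) u) :=
          hlev.mono fun u hu => by
            show _ = (-(2 * ((n : ℝ) + 1)))⁻¹ * Torus.nsGeneratorPairing ν f u _
            rw [nsGeneratorPairing_energyPow_of_isLevel ν f hu n]
            simp only [hI, hD, pow_mul]
            have : (2 * ((n : ℝ) + 1)) ≠ 0 := by positivity
            field_simp
            ring
        exact (hGi.const_mul _).congr hae.symm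
      have hmono := integral_mono_ae hL hRi (hpt n)
      rw [hrow n, integral_sub (((integrable_const (1 : ℝ)).indicator hSm).const_mul _) (hIint.abs.const_mul _),
        integral_const_mul, integral_const_mul, integral_indicator_const (1 : ℝ) hSm, smul_eq_mul,
        mul_one] at hmono
      linarith
    -- let `n → ∞`
    have hq : b / a < 1 := (div_lt_one ha0).2 hba
    have hq0 : 0 ≤ b / a := div_nonneg hb0.le ha0.le
    have hlim : Tendsto (fun n : ℕ => (b / a) ^ (2 * n) * ((∫ u, |I u| ∂μ) / c)) atTop (𝓝 0) := by
      have h1 : Tendsto (fun n : ℕ => ((b / a) ^ 2) ^ n) atTop (𝓝 0) :=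
        tendsto_pow_atTop_nhds_zero_of_lt_one (by positivity) (by nlinarith)
      have h2 := h1.mul_const ((∫ u, |I u| ∂μ) / c)
      rw [zero_mul] at h2
      refine h2.congr fun n => ?_
      rw [← pow_mul]
    have hle : ∀ n : ℕ, μ.real S ≤ (b / a) ^ (2 * n) * ((∫ u, |I u| ∂μ) / c) := by
      intro n
      have h := hK n
      have hapos : 0 < a ^ (2 * n) := pow_pos ha0 _
      rw [div_pow, div_mul_div_comm, le_div_iff₀ (mul_pos hapos hc0)]
      nlinarith
    have hreal : μ.real S ≤ 0 := le_of_tendsto_of_tendsto' tendsto_const_nhds hlim hle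
    have hreal0 : μ.real S = 0 := le_antisymm hreal measureReal_nonneg
    exact (measureReal_eq_zero_iff (measure_ne_top μ S)).1 hreal0
  -- (v) exhaust `{ρ < ‖u‖}` by the shells `{ρ + 1/(n+1) ≤ ‖u‖}`
  have hsub : {u : H3 | ρ < ‖u‖} ⊆ ⋃ n : ℕ, {u | ρ + 1 / ((n : ℝ) + 1) ≤ ‖u‖} := by
    intro u hu
    simp only [Set.mem_setOf_eq] at hu
    obtain ⟨n, hn⟩ := exists_nat_one_div_lt (sub_pos.2 hu)
    exact Set.mem_iUnion.2 ⟨n, by simp only [Set.mem_setOf_eq]; linarith⟩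
  have hU : μ (⋃ n : ℕ, {u : H3 | ρ + 1 / ((n : ℝ) + 1) ≤ ‖u‖}) = 0 :=
    measure_iUnion_null fun n => hnull _ (by
      have : (0 : ℝ) < 1 / ((n : ℝ) + 1) := by positivity
      linarith)
  rw [ae_iff]
  refine measure_mono_null (fun u hu => hsub ?_) hU
  simpa only [Set.mem_setOf_eq, not_le] using hu

/-- **Radius normalisation for witnesses**: a witness with ANY support radius is a witness with the
absorbing radius `‖f‖₂/(4π²ν)`. So in `GalerkinInvariantLoud` the clause `∃ R` can be replaced by the
explicit `R_j = ‖f‖₂/(4π²ν_j)` without loss (and without gain). -/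
theorem IsGILWitness.absorbing {f : T3 → R3} (hf : MemLp f 2 volume) {ν : ℝ} (hν : 0 < ν) {N : ℕ}
    {R E ε : ℝ} {μ : Measure H3} (h : IsGILWitness f ν N R E ε μ) :
    IsGILWitness f ν N (‖hf.toLp f‖ / (4 * Real.pi ^ 2 * ν)) E ε μ := by
  obtain ⟨hp, hl, hR, hinv, hE, hε⟩ := h
  exact ⟨hp, hl, ae_norm_le_absorbing hν hf hl hR hinv, hinv, hE, hε⟩

end Absorbing

/-! ### §3b What a refutation must prove -/

section Shape

/-- **`¬ GalerkinInvariantLoud` unfolded**: a refutation is a UNIFORM-IN-`N` LAMINARISATION THEOREM for 3-D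
Galerkin NS — for every admissible force, every positive `ν_j → 0` and all budgets, SOME viscosity `ν_j` admits,
for every radius and all but finitely many levels, no loud bounded-energy compactly supported invariant law.
Open; believed false (converged DNS, Kaneda et al. 2003). Its 2-D analogue is TRUE (Alexakis–Doering `ε ≲ ν^{1/2}`
via the enstrophy Casimir = route item `PlanarCubicQuiet`); 3-D ball truncations have no definite quadratic
Casimir beyond `span{E, H}` (sibling kit jobs, ≤ 728 modes). -/
theorem not_galerkinInvariantLoud_iff :
    ¬ GalerkinInvariantLoud ↔ ∀ f : T3 → R3, Torus.IsSmooth f → Torus.IsDivFree f → Torus.HasZeroMean f →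
      ∀ (ν : ℕ → ℝ) (E ε : ℝ), (∀ j, 0 < ν j) → Tendsto ν atTop (𝓝 0) → 0 < ε →
      ∃ j : ℕ, ∀ R : ℝ, ∀ᶠ N in atTop, ∀ μ, ¬ IsGILWitness f (ν j) N R E ε μ := by
  rw [galerkinInvariantLoud_iff]
  simp only [not_exists, not_and, not_forall, Filter.not_frequently]

/-- **Only the absorbing radius matters** (§3): the crux fails iff it fails with `R_j = ‖f‖₂/(4π²ν_j)`. -/
theorem not_galerkinInvariantLoud_iff_absorbing :
    ¬ GalerkinInvariantLoud ↔ ∀ f : T3 → R3, Torus.IsSmooth f → Torus.IsDivFree f → Torus.HasZeroMean f →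
      ∀ (ν : ℕ → ℝ) (E ε : ℝ), (∀ j, 0 < ν j) → Tendsto ν atTop (𝓝 0) → 0 < ε →
      ∃ j : ℕ, ∀ᶠ N in atTop, ∀ μ,
        ¬ IsGILWitness f (ν j) N (Real.sqrt (∫ x, ‖f x‖ ^ 2) / (4 * Real.pi ^ 2 * ν j)) E ε μ := by
  rw [not_galerkinInvariantLoud_iff]
  refine forall_congr' fun f => forall_congr' fun hfs => forall_congr' fun hfd => forall_congr' fun hfz =>
    forall_congr' fun ν => forall_congr' fun E => forall_congr' fun ε => forall_congr' fun hν =>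
    forall_congr' fun hν0 => forall_congr' fun hε => exists_congr fun j => ⟨fun h => h _, fun h R => ?_⟩
  refine h.mono fun N hN μ hμ => hN μ ?_
  have := hμ.absorbing (hfs.memLp 2) (hν j)
  rwa [CubicParityLoud.Negative.norm_toLp_eq_sqrt] at this

end Shape

/-! ## §4 NEW — finitely atomic witnesses are mixtures of Galerkin STEADY states

### §4a Polynomial interpolation of gradients at finitely many points of `ℝ^m` -/

section Interp

variable {m : ℕ}

/-- Squared distance to `c`: `Σⱼ (Xⱼ − cⱼ)²`. -/
def sqDist (c : Fin m → ℝ) : MvPolynomial (Fin m) ℝ :=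
  ∑ j, (MvPolynomial.X j - MvPolynomial.C (c j)) ^ 2

/-- The bump `(Σⱼ (Xⱼ − cⱼ)²)²`, vanishing to second order at `c` and positive elsewhere. -/
def bump (c : Fin m → ℝ) : MvPolynomial (Fin m) ℝ := sqDist c ^ 2

/-- `sqDist c` evaluates to the squared distance. -/
theorem eval_sqDist (c v : Fin m → ℝ) : MvPolynomial.eval v (sqDist c) = ∑ j, (v j - c j) ^ 2 := by
  simp [sqDist, map_sum]

/-- `sqDist c` vanishes at `c`. -/
theorem eval_sqDist_self (c : Fin m → ℝ) : MvPolynomial.eval c (sqDist c) = 0 := by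
  simp [eval_sqDist]

/-- `bump c` evaluates to the fourth power of the distance. -/
theorem eval_bump (c v : Fin m → ℝ) : MvPolynomial.eval v (bump c) = (∑ j, (v j - c j) ^ 2) ^ 2 := by
  simp [bump, eval_sqDist]

/-- `bump c` vanishes at `c`. -/
theorem eval_bump_self (c : Fin m → ℝ) : MvPolynomial.eval c (bump c) = 0 := by
  simp [eval_bump]

/-- `bump c` is positive away from `c`. -/
theorem eval_bump_pos {c v : Fin m → ℝ} (h : v ≠ c) : 0 < MvPolynomial.eval v (bump c) := by
  rw [eval_bump]
  have : 0 < ∑ j, (v j - c j) ^ 2 := by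
    obtain ⟨j, hj⟩ : ∃ j, v j ≠ c j := Function.ne_iff.1 h
    exact lt_of_lt_of_le (by positivity : 0 < (v j - c j) ^ 2)
      (Finset.single_le_sum (fun i _ => sq_nonneg (v i - c i)) (Finset.mem_univ j))
  positivity

/-- The gradient of `bump c` vanishes at `c`. -/
theorem eval_pderiv_bump_self (c : Fin m → ℝ) (i : Fin m) :
    MvPolynomial.eval c (MvPolynomial.pderiv i (bump c)) = 0 := by
  rw [bump, Derivation.leibniz_pow]
  simp [eval_sqDist_self]

variable {ι : Type*} (A : Finset ι) (c : ι → Fin m → ℝ)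

/-- The interpolant attached to the atom `a` and the direction `i₀`:
`(X_{i₀} − c_a(i₀)) · Π_{b ∈ A, b ≠ a} bump(c_b)`. -/
def interp [DecidableEq ι] (a : ι) (i₀ : Fin m) : MvPolynomial (Fin m) ℝ :=
  (MvPolynomial.X i₀ - MvPolynomial.C (c a i₀)) * ∏ b ∈ A.erase a, bump (c b)

/-- At another atom `b' ∈ A`, `b' ≠ a`, with `c b' ≠ c a`... all partial derivatives of the interpolant vanish. -/
theorem eval_pderiv_interp_of_ne [DecidableEq ι] {a b' : ι} (hb' : b' ∈ A) (hne : b' ≠ a) (i₀ i : Fin m) :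
    MvPolynomial.eval (c b') (MvPolynomial.pderiv i (interp A c a i₀)) = 0 := by
  have hmem : b' ∈ A.erase a := Finset.mem_erase.2 ⟨hne, hb'⟩
  rw [interp, ← Finset.mul_prod_erase _ _ hmem, Derivation.leibniz, Derivation.leibniz]
  simp [smul_eq_mul, eval_bump_self, eval_pderiv_bump_self]

/-- At its own atom, the gradient of the interpolant is `β • e_{i₀}` with
`β = Π_{b ≠ a} bump(c_b)(c_a)`. -/
theorem eval_pderiv_interp_self [DecidableEq ι] (a : ι) (i₀ i : Fin m) :
    MvPolynomial.eval (c a) (MvPolynomial.pderiv i (interp A c a i₀)) =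
      (if i = i₀ then 1 else 0) * ∏ b ∈ A.erase a, MvPolynomial.eval (c a) (bump (c b)) := by
  rw [interp, Derivation.leibniz]
  simp only [smul_eq_mul, map_add, map_mul, map_sub, MvPolynomial.eval_X, MvPolynomial.eval_C, sub_self,
    zero_mul, zero_add, MvPolynomial.pderiv_C, sub_zero, map_prod, MvPolynomial.pderiv_X]
  by_cases h : i = i₀
  · subst h; simp
  · simp [Ne.symm h, h]

end Interp

/-! ### §4b Finitely atomic invariant laws have Galerkin-steady atoms -/

section Atomic

/-- `u ∈ H` is a GALERKIN STEADY STATE at level `N` for `(ν, f)`: the generator vanishes against every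
level-`N` band test, `⟨F(u), g⟩ = (f,g) + ν(u,Δg) + ∫(u⊗u):∇g = 0` (for level-`N` `u`: `P_N F(u) = 0`). -/
def IsGalerkinSteady (ν : ℝ) (f : T3 → R3) (N : ℕ) (u : H3) : Prop :=
  ∀ g : T3 → R3, IsBandTest N g → Torus.nsGeneratorPairing ν f u g = 0

/-- Frame reconstruction: `Σᵢ (u,gᵢ) gᵢ = P_N u` pointwise. -/
theorem sum_pairing_frameG_smul (N : ℕ) (u : H3) (x : T3) :
    ∑ i, Torus.pairing u.1 (frameG N i) • frameG N i x = Torus.fourierTruncate N ((u : L2T3) : T3 → R3) x := by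
  have h := Torus.sum_galerkinTest_eq (d := Fin 3) N one_pos (fun g => Torus.pairing u.1 g • g x)
  change ∑ i, Torus.pairing u.1 ((Torus.galerkinTest (d := Fin 3) N one_pos).g i) •
      (Torus.galerkinTest (d := Fin 3) N one_pos).g i x = _
  rw [h]
  exact Torus.sum_integral_inner_frameField_smul u.2 N x

/-- **Frame coordinates separate level-`N` fields.** -/
theorem eq_of_pairing_frameG_eq {N : ℕ} {u v : H3} (hu : IsLevel N u) (hv : IsLevel N v)
    (h : ∀ i, Torus.pairing u.1 (frameG N i) = Torus.pairing v.1 (frameG N i)) : u = v := by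
  have hP : ∀ x, Torus.fourierTruncate N ((u : L2T3) : T3 → R3) x =
      Torus.fourierTruncate N ((v : L2T3) : T3 → R3) x := fun x => by
    rw [← sum_pairing_frameG_smul N u x, ← sum_pairing_frameG_smul N v x]
    simp_rw [h]
  have hae : ((u : L2T3) : T3 → R3) =ᵐ[volume] ((v : L2T3) : T3 → R3) := by
    filter_upwards [fourierTruncate_ae_eq_of_isLevel hu, fourierTruncate_ae_eq_of_isLevel hv] with x hxu hxv
    rw [← hxu, ← hxv, hP x]
  exact Subtype.ext (Lp.ext hae)

/-- The tested generator of a polynomial observable is the gradient-weighted sum of the generators of the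
test fields: `⟨F(u), ∇p(u)⟩ = Σᵢ ∂ᵢP(coords u) ⟨F(u), gᵢ⟩`. -/
theorem nsGeneratorPairing_polyGrad {ν : ℝ} {f : T3 → R3} (hf : Integrable f volume) {m : ℕ}
    {g : Fin m → T3 → R3} (hg : ∀ i, Torus.IsSmooth (g i)) (P : MvPolynomial (Fin m) ℝ) (u : H3) :
    Torus.nsGeneratorPairing ν f u (polyGrad g P u) =
      ∑ i, MvPolynomial.eval (fun j => Torus.pairing u.1 (g j)) (MvPolynomial.pderiv i P) *
        Torus.nsGeneratorPairing ν f u (g i) :=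
  Torus.nsGeneratorPairing_sum_smul ν hf u Finset.univ _ fun i _ => hg i

variable {ι : Type*}

/-- The finitely atomic measure `Σ_{a ∈ A} w_a δ_{U a}`. -/
def atomic (A : Finset ι) (w : ι → ℝ≥0∞) (U : ι → H3) : Measure H3 :=
  ∑ a ∈ A, w a • Measure.dirac (U a)

/-- Every observable is integrable against a finitely atomic law with finite weights. -/
theorem integrable_atomic (A : Finset ι) {w : ι → ℝ≥0∞} (U : ι → H3) (hw : ∀ a ∈ A, w a ≠ ⊤)
    (G : H3 → ℝ) : Integrable G (atomic A w U) :=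
  integrable_finsetSum_measure.2 fun a ha => (Torus.integrable_dirac _ _).smul_measure (hw a ha)

/-- Integral against a finitely atomic law: `Σ_a w_a G(U a)`. -/
theorem integral_atomic (A : Finset ι) {w : ι → ℝ≥0∞} (U : ι → H3) (hw : ∀ a ∈ A, w a ≠ ⊤)
    (G : H3 → ℝ) : ∫ u, G u ∂(atomic A w U) = ∑ a ∈ A, (w a).toReal * G (U a) := by
  haveI : MeasurableSingletonClass H3 := OpensMeasurableSpace.toMeasurableSingletonClass
  rw [atomic, integral_finsetSum_measure (fun a ha => (Torus.integrable_dirac _ _).smul_measure (hw a ha))]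
  refine Finset.sum_congr rfl fun a _ => ?_
  rw [integral_smul_measure, integral_dirac, smul_eq_mul]

/-- Lower integral against a finitely atomic law: `Σ_a w_a G(U a)`. -/
theorem lintegral_atomic (A : Finset ι) (w : ι → ℝ≥0∞) (U : ι → H3) (G : H3 → ℝ≥0∞) :
    ∫⁻ u, G u ∂(atomic A w U) = ∑ a ∈ A, w a * G (U a) := by
  haveI : MeasurableSingletonClass H3 := OpensMeasurableSpace.toMeasurableSingletonClass
  rw [atomic, lintegral_finsetSum_measure]
  refine Finset.sum_congr rfl fun a _ => ?_
  rw [lintegral_smul_measure, lintegral_dirac, smul_eq_mul]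

/-- **ATOMS OF A FINITELY ATOMIC INVARIANT LAW ARE GALERKIN STEADY STATES.** If
`μ = Σ_{a∈A} w_a δ_{U a}` (positive finite weights, distinct level-`N` atoms) is all-order polynomially
stationary, then every atom is a Galerkin steady state at level `N`. (Row of the interpolant
`(X₀ − c_a(0)) Π_{b≠a} |X − c_b|⁴` in the coordinates `(g₀, frame)`: its gradient is `β e₀` at `c_a`,
`β > 0`, and `0` at the other atoms, so the row reads `w_a β ⟨F(U a), g₀⟩ = 0`.) Consequence: the
"designer atomic measure" freedom of the lower rungs (QuarticGate's recession-cone line) is VOID here —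
finitely atomic witnesses of `GalerkinInvariantLoud` are finite mixtures of loud bounded Galerkin steady
states, i.e. the open crux of route MirrorVariety (`GalerkinSteadyZerothLaw`-type statements). -/
theorem steady_of_isInvariant_atomic [DecidableEq ι] {ν : ℝ} {f : T3 → R3} (hf : Integrable f volume) {N : ℕ}
    {A : Finset ι} {w : ι → ℝ≥0∞} {U : ι → H3}
    (hw0 : ∀ a ∈ A, w a ≠ 0) (hwt : ∀ a ∈ A, w a ≠ ⊤) (hU : Set.InjOn U A)
    (hlev : ∀ a ∈ A, IsLevel N (U a)) (hinv : IsInvariant ν f N (atomic A w U)) :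
    ∀ a ∈ A, IsGalerkinSteady ν f N (U a) := by
  intro a ha g₀ hg₀
  -- the test family `(g₀, frame)` and the coordinates of the atoms
  set g : Fin ((Torus.galerkinTest (d := Fin 3) N one_pos).m + 1) → T3 → R3 := Fin.cons g₀ (frameG N) with hg
  have hgB : ∀ i, IsBandTest N (g i) := by
    refine Fin.cases ?_ ?_
    · simpa [hg] using hg₀
    · intro i
      rw [hg, Fin.cons_succ]
      exact isBandTest_frameG N i
  have hgS : ∀ i, Torus.IsSmooth (g i) := fun i => (hgB i).1
  set c : ι → Fin ((Torus.galerkinTest (d := Fin 3) N one_pos).m + 1) → ℝ :=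
    fun b j => Torus.pairing (U b).1 (g j) with hc
  -- distinct atoms have distinct coordinates
  have hcinj : ∀ b ∈ A, b ≠ a → c a ≠ c b := by
    intro b hb hba heq
    apply hba
    refine (hU ha hb ?_).symm
    refine eq_of_pairing_frameG_eq (hlev a ha) (hlev b hb) fun i => ?_
    have := congrFun heq (Fin.succ i)
    simpa [hc, hg] using this
  -- the row of the interpolant
  obtain ⟨-, hrow⟩ := hinv _ g (interp A c a 0) hgB
  rw [integral_atomic A U hwt, ← Finset.add_sum_erase _ _ ha] at hrow
  have hrest : ∑ b ∈ A.erase a, (w b).toReal *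
      Torus.nsGeneratorPairing ν f (U b) (polyGrad g (interp A c a 0) (U b)) = 0 := by
    refine Finset.sum_eq_zero fun b hb => ?_
    obtain ⟨hba, hbA⟩ := Finset.mem_erase.1 hb
    rw [nsGeneratorPairing_polyGrad hf hgS]
    have : ∀ i, MvPolynomial.eval (fun j => Torus.pairing (U b).1 (g j))
        (MvPolynomial.pderiv i (interp A c a 0)) = 0 := fun i =>
      eval_pderiv_interp_of_ne A c hbA hba 0 i
    simp [this]
  have hself : Torus.nsGeneratorPairing ν f (U a) (polyGrad g (interp A c a 0) (U a)) =
      (∏ b ∈ A.erase a, MvPolynomial.eval (c a) (bump (c b))) * Torus.nsGeneratorPairing ν f (U a) g₀ := by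
    rw [nsGeneratorPairing_polyGrad hf hgS]
    have : ∀ i, MvPolynomial.eval (fun j => Torus.pairing (U a).1 (g j))
        (MvPolynomial.pderiv i (interp A c a 0)) =
        (if i = 0 then 1 else 0) * ∏ b ∈ A.erase a, MvPolynomial.eval (c a) (bump (c b)) := fun i =>
      eval_pderiv_interp_self A c a 0 i
    simp_rw [this]
    simp [Finset.sum_ite_eq', hg]
  rw [hrest, add_zero, hself] at hrow
  have hβ : 0 < ∏ b ∈ A.erase a, MvPolynomial.eval (c a) (bump (c b)) :=
    Finset.prod_pos fun b hb => eval_bump_pos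
      (hcinj b (Finset.mem_of_mem_erase hb) (Finset.ne_of_mem_erase hb))
  have hwa : 0 < (w a).toReal := ENNReal.toReal_pos (hw0 a ha) (hwt a ha)
  rcases mul_eq_zero.1 hrow with h | h
  · exact absurd h hwa.ne'
  · rcases mul_eq_zero.1 h with h' | h'
    · exact absurd h' hβ.ne'
    · exact h'

/-- Conversely, any finite mixture of Galerkin steady states is all-order stationary (each row is a
gradient-weighted sum of vanishing generators). -/
theorem isInvariant_atomic_of_steady {ν : ℝ} {f : T3 → R3} (hf : Integrable f volume) {N : ℕ}
    {A : Finset ι} {w : ι → ℝ≥0∞} {U : ι → H3} (hwt : ∀ a ∈ A, w a ≠ ⊤)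
    (hst : ∀ a ∈ A, IsGalerkinSteady ν f N (U a)) : IsInvariant ν f N (atomic A w U) := by
  intro m g P hg
  refine ⟨integrable_atomic A U hwt _, ?_⟩
  rw [integral_atomic A U hwt]
  refine Finset.sum_eq_zero fun a ha => ?_
  rw [nsGeneratorPairing_polyGrad hf (fun i => (hg i).1)]
  simp [hst a ha _ (hg _)]

/-- Energy of an atomic law. -/
theorem ensembleEnergy_atomic (A : Finset ι) {w : ι → ℝ≥0∞} (U : ι → H3) (hw : ∀ a ∈ A, w a ≠ ⊤) :
    Torus.ensembleEnergy (atomic A w U) = ∑ a ∈ A, (w a).toReal * ‖U a‖ ^ 2 :=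
  integral_atomic A U hw _

/-- Dissipation of an atomic law with level-`N` atoms. -/
theorem ensembleDissipation_atomic {N : ℕ} (ν : ℝ) (A : Finset ι) {w : ι → ℝ≥0∞} (U : ι → H3)
    (hw : ∀ a ∈ A, w a ≠ ⊤) (hlev : ∀ a ∈ A, IsLevel N (U a)) :
    Torus.ensembleDissipation ν (atomic A w U) =
      ∑ a ∈ A, (w a).toReal * (ν * (Torus.eGradNormSq (((U a : H3) : L2T3) : T3 → R3)).toReal) := by
  unfold Torus.ensembleDissipation Torus.ensembleEnstrophy
  rw [lintegral_atomic, ENNReal.toReal_sum (fun a ha => ENNReal.mul_ne_top (hw a ha)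
    (eGradNormSq_lt_top_of_isLevel (hlev a ha)).ne), Finset.mul_sum]
  refine Finset.sum_congr rfl fun a _ => ?_
  rw [ENNReal.toReal_mul]
  ring

/-- **Pigeonhole on atomic witnesses**: a finitely atomic witness of the crux contains an EFFICIENT loud
steady atom — a level-`N` Galerkin steady state `u` with `ε‖u‖² ≤ E · ν‖∇u‖²` (dissipation-to-energy ratio
at least `ε/E`; the laminar Kolmogorov states have ratio `4π²ν → 0`, so they never serve as `ν → 0`). -/
theorem exists_efficient_steady_atom [DecidableEq ι] {ν : ℝ} {f : T3 → R3} (hf : Integrable f volume)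
    {N : ℕ} {A : Finset ι} {w : ι → ℝ≥0∞} {U : ι → H3}
    (hw0 : ∀ a ∈ A, w a ≠ 0) (hwt : ∀ a ∈ A, w a ≠ ⊤) (hU : Set.InjOn U A)
    (hlev : ∀ a ∈ A, IsLevel N (U a)) {R E ε : ℝ} (hε : 0 < ε)
    (hW : IsGILWitness f ν N R E ε (atomic A w U)) :
    ∃ a ∈ A, IsGalerkinSteady ν f N (U a) ∧
      ε * ‖U a‖ ^ 2 ≤ E * (ν * (Torus.eGradNormSq (((U a : H3) : L2T3) : T3 → R3)).toReal) := by
  obtain ⟨hprob, -, -, hinv, hE, hD⟩ := hW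
  have hst := steady_of_isInvariant_atomic hf hw0 hwt hU hlev hinv
  by_contra hno
  push Not at hno
  rw [ensembleEnergy_atomic A U hwt] at hE
  rw [ensembleDissipation_atomic ν A U hwt hlev] at hD
  -- total mass one, some atom
  have hmass : ∑ a ∈ A, (w a).toReal = 1 := by
    have h1 := integral_atomic A U hwt (fun _ => (1 : ℝ))
    simp only [mul_one] at h1
    rw [← h1, integral_const, smul_eq_mul, mul_one, probReal_univ]
  have hne : A.Nonempty := by
    by_contra h0
    rw [Finset.not_nonempty_iff_eq_empty] at h0
    rw [h0, Finset.sum_empty] at hmass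
    exact zero_ne_one hmass
  have hlt : ∑ a ∈ A, (w a).toReal * (E * (ν * (Torus.eGradNormSq (((U a : H3) : L2T3) : T3 → R3)).toReal)) <
      ∑ a ∈ A, (w a).toReal * (ε * ‖U a‖ ^ 2) :=
    Finset.sum_lt_sum_of_nonempty hne fun a ha =>
      mul_lt_mul_of_pos_left (hno a ha (hst a ha)) (ENNReal.toReal_pos (hw0 a ha) (hwt a ha))
  have h1 : ∑ a ∈ A, (w a).toReal * (E * (ν * (Torus.eGradNormSq (((U a : H3) : L2T3) : T3 → R3)).toReal)) =
      E * ∑ a ∈ A, (w a).toReal * (ν * (Torus.eGradNormSq (((U a : H3) : L2T3) : T3 → R3)).toReal) := by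
    rw [Finset.mul_sum]; exact Finset.sum_congr rfl fun a _ => by ring
  have h2 : ∑ a ∈ A, (w a).toReal * (ε * ‖U a‖ ^ 2) = ε * ∑ a ∈ A, (w a).toReal * ‖U a‖ ^ 2 := by
    rw [Finset.mul_sum]; exact Finset.sum_congr rfl fun a _ => by ring
  rw [h1, h2] at hlt
  have hEn0 : 0 ≤ ∑ a ∈ A, (w a).toReal * ‖U a‖ ^ 2 :=
    Finset.sum_nonneg fun a _ => by positivity
  nlinarith

end Atomic

/-! ## §5 NEW — the mean-flow (linear) row: an ENERGY FLOOR independent of `ε`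

The linear rows say `P_N f = νAū + P_N⟨B(u,u)⟩` (mean momentum balance). Tested against `f` itself (when `f`
is carried by level `N`, e.g. any trigonometric-polynomial force at `N ≥ deg f`):
`‖f‖₂² = −ν⟨(u, Δf)⟩ − ⟨∫(u⊗u):∇f⟩ ≤ |ν| ‖Δf‖₂ √E + C_f E`, `C_f = sup Σᵢ‖∂ᵢf‖`. So the energy budget of a
witness is bounded BELOW by a constant of the force alone, `E ≥ min(1, ‖f‖₂⁴/(4ν²‖Δf‖₂²), ‖f‖₂²/(2C_f))`,
whatever `ε` (the force floor `E ≥ (ε/‖f‖₂)²` degenerates as `ε → 0`; this one does not). Holds verbatim for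
the lower rungs (degree-1 tests). -/

section EnergyFloor

/-- The row of the linear observable `(u, f)` is the generator tested against `f`. -/
theorem nsGeneratorPairing_polyGrad_X {ν : ℝ} {f : T3 → R3} (hfs : Torus.IsSmooth f) (g₀ : T3 → R3)
    (hg₀ : Torus.IsSmooth g₀) (u : H3) :
    Torus.nsGeneratorPairing ν f u (polyGrad (fun _ : Fin 1 => g₀) (MvPolynomial.X 0) u) =
      Torus.nsGeneratorPairing ν f u g₀ := by
  rw [nsGeneratorPairing_polyGrad (hfs.continuous.integrable_unitAddTorus) (fun _ => hg₀)]
  simp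

/-- **ENERGY FLOOR (mean-flow row).** For a smooth force `f` there is `C = C(f) ≥ 0` such that every witness at a
level carrying `f` obeys `∫‖f‖² ≤ |ν| ‖Δf‖₂ √E + C E`. Only the linear row of `(u,f)`, the support bound and
`ensembleEnergy ≤ E` are used. -/
theorem exists_energyFloor {f : T3 → R3} (hfs : Torus.IsSmooth f) :
    ∃ C : ℝ, 0 ≤ C ∧ ∀ {ν : ℝ} {N : ℕ} {R E ε : ℝ} {μ : Measure H3}, IsBandTest N f →
      IsGILWitness f ν N R E ε μ →
        ∫ x, ‖f x‖ ^ 2 ≤ |ν| * Real.sqrt (∫ x, ‖Torus.laplacian f x‖ ^ 2) * Real.sqrt E + C * E := by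
  obtain ⟨C, hC0, hC⟩ := Torus.exists_sum_norm_partialDeriv_le hfs
  refine ⟨C, hC0, fun {ν N R E ε μ} hfB hW => ?_⟩
  obtain ⟨hp, hl, hR, hinv, hE, -⟩ := hW
  have hΔ : MemLp (Torus.laplacian f) 2 volume := hfs.laplacian.memLp 2
  -- the linear row of `(u, f)`
  obtain ⟨hGi, hG0⟩ := hinv 1 (fun _ => f) (MvPolynomial.X 0) (fun _ => hfB)
  simp_rw [nsGeneratorPairing_polyGrad_X hfs f hfs] at hGi hG0
  -- the three summands
  set P : H3 → ℝ := fun u => Torus.pairing u.1 (Torus.laplacian f) with hPdef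
  set Q : H3 → ℝ := fun u => Torus.inertialPairing (u : L2T3) f with hQdef
  have hff : ∫ x, ⟪f x, f x⟫_ℝ = ∫ x, ‖f x‖ ^ 2 :=
    integral_congr_ae (ae_of_all _ fun x => real_inner_self_eq_norm_sq (f x))
  have hexp : ∀ u : H3, Torus.nsGeneratorPairing ν f u f = (∫ x, ‖f x‖ ^ 2) + ν * P u + Q u := by
    intro u
    unfold Torus.nsGeneratorPairing
    rw [hff]
    rfl
  have h1 : Integrable (fun u : H3 => ‖u‖) μ := by simpa using integrable_norm_pow_of_ae_le hR 1
  have h2 : Integrable (fun u : H3 => ‖u‖ ^ 2) μ := integrable_norm_pow_of_ae_le hR 2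
  have hPint : Integrable P μ := integrable_pairing hΔ h1
  have hQbd : ∀ u : H3, |Q u| ≤ C * ‖u‖ ^ 2 := fun u => by
    have h := (Torus.integrable_inner_fderiv_apply_coe hfs hC (u : L2T3) (u : L2T3)).2
    rw [hQdef]
    dsimp only
    rw [Torus.inertialPairing, sq]
    exact h
  have hQint : Integrable Q μ :=
    Integrable.mono' (h2.const_mul C) (Torus.continuous_inertialPairing_coe hfs).aestronglyMeasurable
      (ae_of_all _ fun u => by rw [Real.norm_eq_abs]; exact hQbd u)
  -- integrate the row
  have h12' : Integrable (fun u : H3 => ν * P u) μ := hPint.const_mul ν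
  have h12 : Integrable (fun u : H3 => (∫ x, ‖f x‖ ^ 2) + ν * P u) μ := (integrable_const _).add h12'
  have hsum : (∫ x, ‖f x‖ ^ 2) + ν * (∫ u, P u ∂μ) + ∫ u, Q u ∂μ = 0 := by
    have h := hG0
    simp_rw [hexp] at h
    rw [integral_add h12 hQint, integral_add (integrable_const _) h12', integral_const_mul, integral_const,
      smul_eq_mul, probReal_univ, one_mul] at h
    exact h
  -- bounds
  have hE0 : 0 ≤ Torus.ensembleEnergy μ := integral_nonneg fun u => by positivity
  have hEE : Torus.ensembleEnergy μ ≤ E := hE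
  have hPb : |∫ u, P u ∂μ| ≤ ‖hΔ.toLp (Torus.laplacian f)‖ * Real.sqrt E := by
    calc |∫ u, P u ∂μ| ≤ ∫ u, |P u| ∂μ := abs_integral_le_integral_abs
      _ ≤ ∫ u, ‖u‖ * ‖hΔ.toLp (Torus.laplacian f)‖ ∂μ :=
          integral_mono hPint.abs (h1.mul_const _) fun u => Torus.abs_pairing_coe_le hΔ u
      _ = (∫ u, ‖u‖ ∂μ) * ‖hΔ.toLp (Torus.laplacian f)‖ := integral_mul_const _ _
      _ ≤ Real.sqrt (Torus.ensembleEnergy μ) * ‖hΔ.toLp (Torus.laplacian f)‖ := by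
          refine mul_le_mul_of_nonneg_right ?_ (norm_nonneg _)
          exact (le_abs_self _).trans (Real.abs_le_sqrt (CubicParityLoud.Negative.sq_integral_norm_le h2))
      _ ≤ Real.sqrt E * ‖hΔ.toLp (Torus.laplacian f)‖ :=
          mul_le_mul_of_nonneg_right (Real.sqrt_le_sqrt hEE) (norm_nonneg _)
      _ = ‖hΔ.toLp (Torus.laplacian f)‖ * Real.sqrt E := mul_comm _ _
  have hQb : |∫ u, Q u ∂μ| ≤ C * E := by
    calc |∫ u, Q u ∂μ| ≤ ∫ u, |Q u| ∂μ := abs_integral_le_integral_abs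
      _ ≤ ∫ u, C * ‖u‖ ^ 2 ∂μ := integral_mono hQint.abs (h2.const_mul C) hQbd
      _ = C * Torus.ensembleEnergy μ := by rw [integral_const_mul]; rfl
      _ ≤ C * E := mul_le_mul_of_nonneg_left hEE hC0
  rw [CubicParityLoud.Negative.norm_toLp_eq_sqrt] at hPb
  have hνP : |ν * ∫ u, P u ∂μ| ≤ |ν| * (Real.sqrt (∫ x, ‖Torus.laplacian f x‖ ^ 2) * Real.sqrt E) := by
    rw [abs_mul]
    exact mul_le_mul_of_nonneg_left hPb (abs_nonneg ν)
  have key : ∫ x, ‖f x‖ ^ 2 = -(ν * ∫ u, P u ∂μ) - ∫ u, Q u ∂μ := by linarith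
  rw [key]
  nlinarith [neg_abs_le (ν * ∫ u, P u ∂μ), le_abs_self (ν * ∫ u, P u ∂μ), neg_abs_le (∫ u, Q u ∂μ),
    le_abs_self (∫ u, Q u ∂μ)]

end EnergyFloor

/-! ## §6 Line `taylor-cone-homogenisation` (PICKED 2026-08-16T06:14Z by prover-line-stmt-AnomalousDissipation-14283-0)

Skeleton `Cruxes/GalerkinInvariantLoud/Lines/taylor_cone_homogenisation.lean` (rc 0, 4 sorries; composition
`GalerkinInvariantLoud_of` is `proof-of-item` by name modulo S1–S4 — joint sufficiency kernel-checked by this seat).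
Cheap-falsity pass on the stubs AS TYPED (details in the docblock's Line section): S1 `stub_energyFloor` TRUE
(degree-≤1 row of `(u, P_N f)`, = §5 with the truncation bookkeeping; no level clause needed in its proof);
S2 `stub_taylorReduction` TRUE (bookkeeping: ceiling `e ≤ ‖f‖₂²/κ²` from the energy row, loudness `κe₀` from S1,
re-indexing past `ν₀`); S3 `stub_krylovBogoliubov` TRUE for the genuine semiflow `Torus.galerkinFlow` (identity
off Galerkin modes — excluded by `IsGalerkinMode N a`; `κ ≤ 0` is served by any steady Dirac, `0/0 := 0` and the
Bernstein bound keep `Filter.liminf` honest) — its absorbing radius is exactly §3's; S4 `stub_oneTrajectoryTaylor`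
is the crux in ratio currency (GIL ⇒ S4 morally by ergodic decomposition + Birkhoff; S4 ⇒ GIL by S3+S2+S1), not
cheaply decidable; no stub instantiates a refuted strengthening. What IS load-bearing in the line's currency is the
`j`-UNIFORMITY of `κ` alone: -/

section LineTaylorCone

/-- TSE, the Taylor-scale ensemble (verbatim second hypothesis of `stub_taylorReduction` / conclusion of
`taylorConverse`): invariant level-`N` laws in the cone `κ·e ≤ D` with ONE `κ > 0` for all `j`. -/
def TSE : Prop :=
  ∃ f : T3 → R3, Torus.IsSmooth f ∧ Torus.IsDivFree f ∧ Torus.HasZeroMean f ∧ f ≠ 0 ∧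
    ∃ (ν : ℕ → ℝ) (κ : ℝ), (∀ j, 0 < ν j) ∧ Tendsto ν atTop (𝓝 0) ∧ 0 < κ ∧
      ∀ j : ℕ, ∃ R : ℝ, ∃ᶠ N in atTop, ∃ μ : Measure H3,
        IsProbabilityMeasure μ ∧ (∀ᵐ u ∂μ, IsLevel N u) ∧ (∀ᵐ u ∂μ, ‖u‖ ≤ R) ∧
        (∀ d : ℕ, IsPolyStationary (ν j) f N d μ) ∧
        κ * Torus.ensembleEnergy μ ≤ Torus.ensembleDissipation (ν j) μ

/-- WEAKENING of TSE (holds trivially): the cone slope `κ` chosen AFTER `j`. -/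
def TSEWithoutUniformKappa : Prop :=
  ∃ f : T3 → R3, Torus.IsSmooth f ∧ Torus.IsDivFree f ∧ Torus.HasZeroMean f ∧ f ≠ 0 ∧
    ∃ ν : ℕ → ℝ, (∀ j, 0 < ν j) ∧ Tendsto ν atTop (𝓝 0) ∧
      ∀ j : ℕ, ∃ κ : ℝ, 0 < κ ∧ ∃ R : ℝ, ∃ᶠ N in atTop, ∃ μ : Measure H3,
        IsProbabilityMeasure μ ∧ (∀ᵐ u ∂μ, IsLevel N u) ∧ (∀ᵐ u ∂μ, ‖u‖ ≤ R) ∧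
        (∀ d : ℕ, IsPolyStationary (ν j) f N d μ) ∧
        κ * Torus.ensembleEnergy μ ≤ Torus.ensembleDissipation (ν j) μ

/-- The Kolmogorov field `K_1` is not the zero force. -/
theorem kolField_one_ne_zero : kolField 1 ≠ 0 := by
  intro h
  have h1 := integral_norm_sq_kolField 1
  rw [h] at h1
  simp at h1

/-- **The laminar Dirac sits ON the cone of slope `4π²ν`**: `4π²ν · e = D` for `δ_{K_a}` (`e = a²/2`,
`D = 2π²νa²`) — the Poincaré-extremal ratio, `→ 0` with `ν`. -/
theorem laminar_cone_eq (ν a : ℝ) :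
    4 * Real.pi ^ 2 * ν * Torus.ensembleEnergy (Measure.dirac (kolState a)) =
      Torus.ensembleDissipation ν (Measure.dirac (kolState a)) := by
  rw [ensembleEnergy_dirac_kolState, ensembleDissipation_dirac_kolState]
  ring

/-- **The `j`-uniformity of `κ` is THE load-bearing clause of TSE** (hence of S4): with `κ_j := 4π²ν_j` the
laminar Kolmogorov Diracs `δ_{K_1/(4π²ν_j)}` are all-order invariant level-1 cone witnesses at every `j`
(force `K_1 ≠ 0`, radius `(4π²ν_j)⁻¹`). Any proof of S4/TSE must produce orbits/laws beating the Poincaré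
ratio `4π²ν_j` by the factor `κ/(4π²ν_j) → ∞` — spectral centroid at the Taylor wavenumber, uniformly. -/
theorem tseWithoutUniformKappa_holds : TSEWithoutUniformKappa := by
  have hpi : 0 < Real.pi := Real.pi_pos
  refine ⟨kolField 1, isSmooth_kolField 1, isDivFree_kolField 1, hasZeroMean_kolField 1, kolField_one_ne_zero,
    fun j => 1 / ((j : ℝ) + 1), fun j => by positivity, tendsto_one_div_add_atTop_nhds_zero_nat, fun j => ?_⟩
  set ν : ℝ := 1 / ((j : ℝ) + 1) with hν
  have hν0 : 0 < ν := by positivity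
  refine ⟨4 * Real.pi ^ 2 * ν, by positivity, (4 * Real.pi ^ 2 * ν)⁻¹,
    (eventually_ge_atTop 1).frequently.mono fun N hN => ?_⟩
  obtain ⟨hp, hl, hR, hinv, -, -⟩ := isGILWitness_dirac_kolState hν0 hN
  exact ⟨_, hp, hl, hR, (isInvariant_iff_forall).1 hinv, (laminar_cone_eq ν _).le⟩

/-- TSE ⇒ every cone witness obeys the Taylor-level floor `κ ≤ 4π²N²ν_j` as soon as its energy is positive
(Bernstein; the skeleton's `cone_level`), and the force/radius floors of §2 with `ε := κ·e(μ)`. In particular a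
cone family with uniform `κ` lives at levels `N ≥ (κ/ν_j)^{1/2}/(2π) → ∞`. -/
theorem cone_level' {f : T3 → R3} {ν : ℝ} (hν : 0 ≤ ν) {N : ℕ} {R κ : ℝ} {μ : Measure H3}
    (hp : IsProbabilityMeasure μ) (hl : ∀ᵐ u ∂μ, IsLevel N u) (hR : ∀ᵐ u ∂μ, ‖u‖ ≤ R)
    (hinv : ∀ d : ℕ, IsPolyStationary ν f N d μ)
    (hcone : κ * Torus.ensembleEnergy μ ≤ Torus.ensembleDissipation ν μ) (he : 0 < Torus.ensembleEnergy μ) :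
    κ ≤ 4 * Real.pi ^ 2 * (N : ℝ) ^ 2 * ν := by
  have hW : IsQuarticWitness f ν N (Torus.ensembleEnergy μ) (κ * Torus.ensembleEnergy μ) μ :=
    ⟨hp, hl, integrable_norm_pow_of_ae_le hR 4, hinv 4, le_rfl, hcone⟩
  exact le_of_mul_le_mul_right (hW.eps_le hν) he

end LineTaylorCone

end

end Summit.AnomalousDissipation.AnomalousDissipation.Cruxes.GalerkinInvariantLoud.Disproof
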